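import Literature.NumberTheory.Sieve.KloostermanQuadraticForms
import Literature.Analysis.Asymptotics.IteratedNonStationaryPhase
import Literature.NumberTheory.Sieve.DivisorBound
import Literature.NumberTheory.Sieve.FriedlanderIwaniecPrimesPoisson
import Mathlib.Analysis.Fourier.PoissonSummation
import Mathlib.Analysis.SpecialFunctions.SmoothTransition
import Mathlib.NumberTheory.Harmonic.Bounds
import HarnessLib

/-!
# Quadratic forms with Kloosterman sums, short moduli (Deshouillers–Iwaniec 1982, Proposition 3 (1.27))

This file completes the proof of [DeshouillersIwaniec1982, Proposition 3] begun in
`KloostermanQuadraticForms.lean`: for the quadratic form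
`B(θ, c, N) = ∑_{N<m,n≤2N} b_m b̄_n S(m, n; c) e(2√(mn)θ/c)` (`quadB θ c N b`) and `0 < |θ| ≤ 2`,
`1 ≤ c ≤ N`, we prove (1.27) in the form

  `‖B(θ, c, N)‖ ≤ A_ε |θ|^{-1/2} c^{1/2} N^{1/2+ε} ‖b‖²`      (`norm_quadB_le_short`),

for every `ε > 0`, with a constant `A_ε` depending on `ε` alone.  The proof is the one printed
on pp. 256–257 of the source: Cauchy–Schwarz in `n` with a smooth majorant `η(n/N)` of the dyadic
range, opening the two Kloosterman sums, Poisson summation in `n`; the non-zero frequencies are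
negligible by `p = ⌈2/ε⌉ + 1` integrations by parts (the tree's iterated non-stationary phase
`Asymptotics.norm_integral_mul_phaseExp_le`; the point "`|A − u| ≥ 1/c` while `|B|/2√t ≤ 2(√2−1)/c`"
is `abs_phaseDeriv_ge`), and the zero frequency is a Ramanujan sum `c_c(m₁ − m₂)` (tree:
`ramanujanSum`, `|c_c(h)| ≤ (h, c)`) against `∫ η(t/N) e(B√t) dt ≪ cN/(θ|m₁ − m₂|)` (one integration by
parts); for `N^{1−ε} < c ≤ N` the bound follows from (1.26) (`norm_quadB_le_largeSieve`).

Technical devices (all PROVED, no hypotheses): the smooth square root `smoothSqrt N` (equal to `√t`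
on `[0.96N, 2.04N]`, with globally small derivative), so that the phase of the Fourier integrals
is a globally smooth function with `|ψ'| ≥ |A − u|/8`; jet bounds for the scaled cutoffs and for
`t ↦ (2√t)⁻¹`; Mathlib's Poisson summation `Real.tsum_eq_tsum_fourierIntegral_of_rpow_decay`.

## References
* [DeshouillersIwaniec1982] J.-M. Deshouillers, H. Iwaniec, *Kloosterman sums and Fourier coefficients
  of cusp forms*, Invent. Math. 70 (1982), 219–288: Proposition 3 (1.27) p. 229, proof pp. 256–257.
-/

noncomputable section

open Finset Real MeasureTheory Complex Set Filter
open scoped ComplexConjugate FourierTransform ContDiff Topology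

namespace Literature.NumberTheory.Sieve

namespace DeshouillersIwaniec

open BFI LFunctions LargeSieve Literature.Analysis.Asymptotics

/-! ### Two fixed cutoffs and their jets -/

/-- The smooth majorant `η₀` of `(1, 2]`: `η₀ = 1` on `[0.98, 2.02]`, `0 ≤ η₀ ≤ 1`, supported in
`(0.96, 2.04)`. [folklore] -/
def eta0 : ContDiffBump (3 / 2 : ℝ) := ⟨13 / 25, 27 / 50, by norm_num, by norm_num⟩

/-- The wider cutoff `χ₀`: `χ₀ = 1` on `[0.96, 2.04]`, supported in `(0.94, 2.06)`. [folklore] -/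
def chi0 : ContDiffBump (3 / 2 : ℝ) := ⟨27 / 50, 14 / 25, by norm_num, by norm_num⟩

/-- A common bound for the first `p + 1` derivatives of a smooth compactly supported function.
[folklore] -/
theorem exists_jet_bound {f : ℝ → ℝ} (hf : ContDiff ℝ ∞ f) (hfs : HasCompactSupport f) (p : ℕ) :
    ∃ M : ℝ, 1 ≤ M ∧ ∀ j ≤ p, ∀ x, |iteratedDeriv j f x| ≤ M := by
  induction p with
  | zero =>
    obtain ⟨M, hM⟩ := hf.continuous.bounded_above_of_compact_support hfs
    refine ⟨max M 1, le_max_right _ _, fun j hj x => ?_⟩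
    rw [Nat.le_zero.1 hj, iteratedDeriv_zero]
    exact (Real.norm_eq_abs _ ▸ hM x).trans (le_max_left _ _)
  | succ p ih =>
    obtain ⟨M, hM1, hM⟩ := ih
    -- iterated derivatives of a compactly supported function are compactly supported
    have hcs : ∀ n : ℕ, HasCompactSupport (iteratedDeriv n f) := fun n => by
      induction n with
      | zero => simpa using hfs
      | succ n ih' => rw [iteratedDeriv_succ]; exact ih'.deriv
    obtain ⟨M', hM'⟩ := (hf.continuous_iteratedDeriv (p + 1) (by exact_mod_cast le_top)).bounded_above_of_compact_support
      (hcs (p + 1))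
    refine ⟨max M M', le_max_of_le_left hM1, fun j hj x => ?_⟩
    rcases Nat.of_le_succ hj with h | h
    · exact (hM j h x).trans (le_max_left _ _)
    · subst h; exact (Real.norm_eq_abs _ ▸ hM' x).trans (le_max_right _ _)

/-- **Jets of a scaled cutoff**: if `|f^{(j)}| ≤ M` for `j ≤ p` then
`|(f(·/N))^{(j)}(t)| ≤ M / N^j` (`N > 0`). [folklore] -/
theorem norm_iteratedDeriv_scaled_le {f : ℝ → ℝ} (hf : ContDiff ℝ ∞ f) {p : ℕ} {M : ℝ}
    (hM : ∀ j ≤ p, ∀ x, |iteratedDeriv j f x| ≤ M) {N : ℝ} (hN : 0 < N) :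
    ∀ j ≤ p, ∀ t, ‖iteratedDeriv j (fun s : ℝ => ((f (N⁻¹ * s) : ℝ) : ℂ)) t‖ ≤ M / N ^ j := by
  intro j hj t
  have hof : (fun s : ℝ => ((f (N⁻¹ * s) : ℝ) : ℂ)) = fun s => ((fun x => ((f x : ℝ) : ℂ)) (N⁻¹ * s)) := rfl
  have hfc : ContDiff ℝ ∞ (fun x : ℝ => ((f x : ℝ) : ℂ)) := ofRealCLM.contDiff.comp hf
  rw [hof, iteratedDeriv_comp_const_smul (hfc.of_le (by exact_mod_cast le_top)) (N⁻¹ : ℝ)]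
  dsimp only
  rw [norm_smul, norm_pow, Real.norm_eq_abs, abs_inv, abs_of_pos hN, inv_pow]
  -- `iteratedDeriv` commutes with the coercion `ℝ → ℂ`
  have hco : ∀ (k : ℕ) (x : ℝ), iteratedDeriv k (fun x : ℝ => ((f x : ℝ) : ℂ)) x = ((iteratedDeriv k f x : ℝ) : ℂ) := by
    intro k
    induction k with
    | zero => intro x; simp
    | succ k ih =>
      intro x
      rw [iteratedDeriv_succ, iteratedDeriv_succ]
      have hfun : iteratedDeriv k (fun x : ℝ => ((f x : ℝ) : ℂ)) = fun x => ((iteratedDeriv k f x : ℝ) : ℂ) := funext ih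
      rw [hfun]
      have hd : HasDerivAt (iteratedDeriv k f) (deriv (iteratedDeriv k f) x) x :=
        ((hf.differentiable_iteratedDeriv k (by exact_mod_cast WithTop.coe_lt_top _)) x).hasDerivAt
      exact hd.ofReal_comp.deriv
  rw [hco, Complex.norm_real, Real.norm_eq_abs, div_eq_inv_mul]
  exact mul_le_mul_of_nonneg_left (hM j hj _) (by positivity)

/-! ### The smooth square root -/

/-- `ν_N(t) = 0.45N + S((t − 0.45N)/0.45N)(t − 0.45N)` (`S` = `Real.smoothTransition`): smooth,
`ν_N ≥ 0.45N`, and `ν_N(t) = t` for `t ≥ 0.9N`. [folklore] -/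
def nuFun (N t : ℝ) : ℝ := 9 / 20 * N + Real.smoothTransition ((t - 9 / 20 * N) / (9 / 20 * N)) * (t - 9 / 20 * N)

/-- `ν_N` is smooth. [folklore] -/
theorem contDiff_nuFun (N : ℝ) : ContDiff ℝ ∞ (nuFun N) := by
  unfold nuFun
  refine contDiff_const.add (ContDiff.mul ?_ (contDiff_id.sub contDiff_const))
  exact Real.smoothTransition.contDiff.comp ((contDiff_id.sub contDiff_const).div_const _)

/-- `ν_N(t) ≥ 0.45N` for `N > 0`. [folklore] -/
theorem nuFun_ge {N : ℝ} (hN : 0 < N) (t : ℝ) : 9 / 20 * N ≤ nuFun N t := by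
  unfold nuFun
  by_cases ht : t ≤ 9 / 20 * N
  · have : Real.smoothTransition ((t - 9 / 20 * N) / (9 / 20 * N)) = 0 :=
      Real.smoothTransition.zero_of_nonpos (div_nonpos_of_nonpos_of_nonneg (by linarith) (by positivity))
    rw [this]; linarith
  · push Not at ht
    have h0 := Real.smoothTransition.nonneg ((t - 9 / 20 * N) / (9 / 20 * N))
    nlinarith

/-- `ν_N(t) = t` for `t ≥ 0.9N` (`N > 0`). [folklore] -/
theorem nuFun_eq_self {N : ℝ} (hN : 0 < N) {t : ℝ} (ht : 9 / 10 * N ≤ t) : nuFun N t = t := by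
  unfold nuFun
  have : Real.smoothTransition ((t - 9 / 20 * N) / (9 / 20 * N)) = 1 :=
    Real.smoothTransition.one_of_one_le ((one_le_div (by positivity)).2 (by linarith))
  rw [this]; ring

/-- `ν_N > 0`. [folklore] -/
theorem nuFun_pos {N : ℝ} (hN : 0 < N) (t : ℝ) : 0 < nuFun N t := lt_of_lt_of_le (by positivity) (nuFun_ge hN t)

/-- The smooth reciprocal square root `ι_N(t) = (2√ν_N(t))⁻¹`, equal to `(2√t)⁻¹` for `t ≥ 0.9N`. [folklore] -/
def iotaFun (N t : ℝ) : ℝ := (2 * Real.sqrt (nuFun N t))⁻¹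

/-- `ι_N` is smooth (`N > 0`). [folklore] -/
theorem contDiff_iotaFun {N : ℝ} (hN : 0 < N) : ContDiff ℝ ∞ (iotaFun N) := by
  unfold iotaFun
  refine ContDiff.inv (contDiff_const.mul ?_) fun t => ?_
  · exact (contDiff_nuFun N).sqrt fun t => (nuFun_pos hN t).ne'
  · exact mul_ne_zero two_ne_zero (Real.sqrt_ne_zero'.2 (nuFun_pos hN t))

/-- `ι_N = (2√·)⁻¹` near every `t > 0.9N`. [folklore] -/
theorem iotaFun_eventuallyEq {N : ℝ} (hN : 0 < N) {t : ℝ} (ht : 9 / 10 * N < t) :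
    (iotaFun N) =ᶠ[𝓝 t] fun s => (2 * Real.sqrt s)⁻¹ := by
  filter_upwards [Ioi_mem_nhds ht] with s hs
  rw [iotaFun, nuFun_eq_self hN (le_of_lt hs)]

/-- `0 ≤ ι_N(t) ≤ (2√(0.45N))⁻¹`. [folklore] -/
theorem iotaFun_nonneg_le {N : ℝ} (hN : 0 < N) (t : ℝ) :
    0 ≤ iotaFun N t ∧ iotaFun N t ≤ (2 * Real.sqrt (9 / 20 * N))⁻¹ := by
  unfold iotaFun
  refine ⟨by positivity, ?_⟩
  exact inv_anti₀ (by positivity) (mul_le_mul_of_nonneg_left (Real.sqrt_le_sqrt (nuFun_ge hN t)) two_pos.le)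

/-- The cut-off reciprocal square root `σ_N(t) = χ₀(t/N) ι_N(t)`: smooth, equal to `(2√t)⁻¹` on
`[0.96N, 2.04N]` and to `0` off `(0.94N, 2.06N)`, and `|σ_N| ≤ (2√(0.94N))⁻¹` everywhere. [folklore] -/
def sigmaFun (N t : ℝ) : ℝ := (chi0 : ℝ → ℝ) (N⁻¹ * t) * iotaFun N t

/-- `σ_N` is smooth. [folklore] -/
theorem contDiff_sigmaFun {N : ℝ} (hN : 0 < N) : ContDiff ℝ ∞ (sigmaFun N) :=
  (chi0.contDiff.comp (contDiff_const.mul contDiff_id)).mul (contDiff_iotaFun hN)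

/-- `σ_N` is continuous. [folklore] -/
theorem continuous_sigmaFun {N : ℝ} (hN : 0 < N) : Continuous (sigmaFun N) := (contDiff_sigmaFun hN).continuous

/-- Where `χ₀(t/N) ≠ 0` we have `t > 0.94N`, and where it is `0` we are off `(0.94N, 2.06N)`:
precisely `χ₀(t/N) ≠ 0 → 0.94 N < t ∧ t < 2.06 N`. [folklore] -/
theorem chi0_scaled_support {N : ℝ} (hN : 0 < N) {t : ℝ} (h : (chi0 : ℝ → ℝ) (N⁻¹ * t) ≠ 0) :
    47 / 50 * N < t ∧ t < 103 / 50 * N := by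
  have hmem : N⁻¹ * t ∈ Function.support (chi0 : ℝ → ℝ) := h
  rw [chi0.support_eq, Metric.mem_ball, Real.dist_eq] at hmem
  have h14 : (chi0).rOut = 14 / 25 := rfl
  rw [h14, abs_lt] at hmem
  have e : N⁻¹ * t = t / N := by rw [inv_mul_eq_div]
  rw [e] at hmem
  constructor
  · have := hmem.1; rw [lt_sub_iff_add_lt, lt_div_iff₀ hN] at this; linarith
  · have := hmem.2; rw [sub_lt_iff_lt_add, div_lt_iff₀ hN] at this; linarith

/-- `χ₀(t/N) = 1` for `0.96N ≤ t ≤ 2.04N`. [folklore] -/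
theorem chi0_scaled_eq_one {N : ℝ} (hN : 0 < N) {t : ℝ} (h1 : 24 / 25 * N ≤ t) (h2 : t ≤ 51 / 25 * N) :
    (chi0 : ℝ → ℝ) (N⁻¹ * t) = 1 := by
  apply chi0.one_of_mem_closedBall
  rw [Metric.mem_closedBall, Real.dist_eq, show (chi0).rIn = 27 / 50 from rfl, abs_le, inv_mul_eq_div]
  constructor
  · rw [le_sub_iff_add_le, le_div_iff₀ hN]; linarith
  · rw [sub_le_iff_le_add, div_le_iff₀ hN]; linarith

/-- `σ_N(t) = (2√t)⁻¹` for `0.96N ≤ t ≤ 2.04N`. [folklore] -/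
theorem sigmaFun_eq {N : ℝ} (hN : 0 < N) {t : ℝ} (h1 : 24 / 25 * N ≤ t) (h2 : t ≤ 51 / 25 * N) :
    sigmaFun N t = (2 * Real.sqrt t)⁻¹ := by
  rw [sigmaFun, chi0_scaled_eq_one hN h1 h2, one_mul, iotaFun, nuFun_eq_self hN (by linarith)]

/-- `σ_N(t) = 0` unless `0.94N < t < 2.06N`. [folklore] -/
theorem sigmaFun_eq_zero {N : ℝ} (hN : 0 < N) {t : ℝ} (h : ¬ (47 / 50 * N < t ∧ t < 103 / 50 * N)) :
    sigmaFun N t = 0 := by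
  rw [sigmaFun]
  by_contra hne
  exact h (chi0_scaled_support hN (left_ne_zero_of_mul hne))

/-- **Global size of `σ_N`**: `|σ_N(t)| ≤ (2√(0.94 N))⁻¹`. [folklore] -/
theorem abs_sigmaFun_le {N : ℝ} (hN : 0 < N) (t : ℝ) : |sigmaFun N t| ≤ (2 * Real.sqrt (47 / 50 * N))⁻¹ := by
  by_cases h : 47 / 50 * N < t ∧ t < 103 / 50 * N
  · rw [sigmaFun, iotaFun, nuFun_eq_self hN (by linarith [h.1]), abs_mul, abs_of_nonneg (chi0.nonneg),
      abs_of_nonneg (by positivity)]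
    calc (chi0 : ℝ → ℝ) (N⁻¹ * t) * (2 * Real.sqrt t)⁻¹ ≤ 1 * (2 * Real.sqrt t)⁻¹ :=
          mul_le_mul_of_nonneg_right chi0.le_one (by positivity)
      _ ≤ (2 * Real.sqrt (47 / 50 * N))⁻¹ := by
          rw [one_mul]
          exact inv_anti₀ (by positivity) (mul_le_mul_of_nonneg_left (Real.sqrt_le_sqrt h.1.le) two_pos.le)
  · rw [sigmaFun_eq_zero hN h, abs_zero]; positivity

/-- The smooth square root `Σ_N(t) = √(0.96N) + ∫_{0.96N}^t σ_N`. [folklore] -/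
def smoothSqrt (N t : ℝ) : ℝ := Real.sqrt (24 / 25 * N) + ∫ s in (24 / 25 * N)..t, sigmaFun N s

/-- `Σ_N' = σ_N`. [folklore] -/
theorem hasDerivAt_smoothSqrt {N : ℝ} (hN : 0 < N) (t : ℝ) : HasDerivAt (smoothSqrt N) (sigmaFun N t) t := by
  unfold smoothSqrt
  have hc := continuous_sigmaFun hN
  exact ((intervalIntegral.integral_hasDerivAt_right (hc.intervalIntegrable _ _)
    (hc.stronglyMeasurableAtFilter _ _) hc.continuousAt).const_add _)

/-- **`Σ_N(t) = √t` on `[0.96N, 2.04N]`.** [folklore] -/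
theorem smoothSqrt_eq_sqrt {N : ℝ} (hN : 0 < N) {t : ℝ} (h1 : 24 / 25 * N ≤ t) (h2 : t ≤ 51 / 25 * N) :
    smoothSqrt N t = Real.sqrt t := by
  -- `D = Σ_N − √` has derivative `0` on `[0.96N, t]` and vanishes at `0.96N`
  set a : ℝ := 24 / 25 * N with ha
  have ha0 : 0 < a := by positivity
  set D : ℝ → ℝ := fun s => smoothSqrt N s - Real.sqrt s with hD
  have hcont : ContinuousOn D (Icc a t) := fun s _ =>
    ((hasDerivAt_smoothSqrt hN s).continuousAt.sub Real.continuous_sqrt.continuousAt).continuousWithinAt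
  have hder : ∀ s ∈ Ico a t, HasDerivWithinAt D 0 (Ici s) s := by
    intro s hs
    have hs0 : 0 < s := ha0.trans_le hs.1
    have h := ((hasDerivAt_smoothSqrt hN s).sub (Real.hasDerivAt_sqrt hs0.ne')).hasDerivWithinAt (s := Ici s)
    rw [sigmaFun_eq hN hs.1 (hs.2.le.trans h2), one_div, sub_self] at h
    exact h
  have h := constant_of_has_deriv_right_zero hcont hder t (right_mem_Icc.2 h1)
  have hDa : D a = 0 := by simp [hD, smoothSqrt, ha]
  have : D t = 0 := h.trans hDa
  simpa [hD, sub_eq_zero] using this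

/-! ### Jets of `(2√t)⁻¹`, of `ι_N` and of `σ_N` -/

/-- `iteratedDeriv` commutes with the coercion `ℝ → ℂ` for smooth functions. [folklore] -/
theorem iteratedDeriv_ofReal_comp {f : ℝ → ℝ} (hf : ContDiff ℝ ∞ f) (k : ℕ) (x : ℝ) :
    iteratedDeriv k (fun x : ℝ => ((f x : ℝ) : ℂ)) x = ((iteratedDeriv k f x : ℝ) : ℂ) := by
  induction k generalizing x with
  | zero => simp
  | succ k ih =>
    rw [iteratedDeriv_succ, iteratedDeriv_succ]
    have hfun : iteratedDeriv k (fun x : ℝ => ((f x : ℝ) : ℂ)) = fun x => ((iteratedDeriv k f x : ℝ) : ℂ) := funext ih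
    rw [hfun]
    have hd : HasDerivAt (iteratedDeriv k f) (deriv (iteratedDeriv k f) x) x :=
      ((hf.differentiable_iteratedDeriv k (by exact_mod_cast WithTop.coe_lt_top _)) x).hasDerivAt
    exact hd.ofReal_comp.deriv

/-- `|(X)(X−1)⋯(X−j+1)|` at `X = −1/2` is at most `j!`. [folklore] -/
theorem abs_descPochhammer_eval_le (j : ℕ) : |(descPochhammer ℝ j).eval (-(1 / 2 : ℝ))| ≤ j.factorial := by
  induction j with
  | zero => simp
  | succ j ih =>
    rw [descPochhammer_succ_right, Polynomial.eval_mul, abs_mul, Nat.factorial_succ, Nat.cast_mul]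
    have h2 : |Polynomial.eval (-(1 / 2 : ℝ)) (Polynomial.X - (j : Polynomial ℝ))| = j + 1 / 2 := by
      simp only [Polynomial.eval_sub, Polynomial.eval_X, Polynomial.eval_natCast]
      rw [abs_of_neg (by linarith [(Nat.cast_nonneg j : (0:ℝ) ≤ j)])]
      ring
    rw [h2]
    have hj0 : (0 : ℝ) ≤ j := Nat.cast_nonneg j
    calc |Polynomial.eval (-(1 / 2 : ℝ)) (descPochhammer ℝ j)| * ((j : ℝ) + 1 / 2)
        ≤ (j.factorial : ℝ) * ((j : ℝ) + 1) := mul_le_mul ih (by linarith) (by positivity) (by positivity)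
      _ = ((j + 1 : ℕ) : ℝ) * (j.factorial : ℝ) := by push_cast; ring

/-- **Jets of `t ↦ (2√t)⁻¹` at `t > 0`**: the `j`-th derivative is `(1/2) P_j(−1/2) t^{−1/2−j}` with
`|P_j(−1/2)| ≤ j!`, whence `≤ j! t^{-1/2-j}/2`. [folklore] -/
theorem norm_iteratedDeriv_inv_two_sqrt_le {t : ℝ} (ht : 0 < t) (j : ℕ) :
    |iteratedDeriv j (fun s : ℝ => (2 * Real.sqrt s)⁻¹) t| ≤ (j.factorial : ℝ) / 2 * t ^ (-(1 / 2 : ℝ) - j) := by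
  -- near `t` the function is `(1/2) s^{-1/2}`
  have hev : (fun s : ℝ => (2 * Real.sqrt s)⁻¹) =ᶠ[𝓝 t] fun s => (1 / 2 : ℝ) * s ^ (-(1 / 2 : ℝ)) := by
    filter_upwards [Ioi_mem_nhds ht] with s hs
    rw [Real.sqrt_eq_rpow, Real.rpow_neg (le_of_lt hs), mul_inv]
    ring
  rw [hev.iteratedDeriv_eq, iteratedDeriv_const_mul_field, iteratedDeriv_eq_iterate, iter_deriv_rpow_const,
    abs_mul, abs_mul, abs_of_pos (by norm_num : (0:ℝ) < 1 / 2),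
    abs_of_pos (Real.rpow_pos_of_pos ht _)]
  have := abs_descPochhammer_eval_le j
  calc 1 / 2 * (|Polynomial.eval (-(1 / 2 : ℝ)) (descPochhammer ℝ j)| * t ^ (-(1 / 2 : ℝ) - j))
      ≤ 1 / 2 * ((j.factorial : ℝ) * t ^ (-(1 / 2 : ℝ) - j)) := by gcongr
    _ = _ := by ring

/-- `t^{-1/2-j} ≤ 2^{j+1} (√N)⁻¹ / N^j` for `t ≥ N/2 > 0`. [folklore] -/
theorem rpow_neg_half_sub_le {N t : ℝ} (hN : 0 < N) (ht : N / 2 ≤ t) (j : ℕ) :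
    t ^ (-(1 / 2 : ℝ) - j) ≤ 2 ^ (j + 1) * (Real.sqrt N)⁻¹ / N ^ j := by
  have hN2 : 0 < N / 2 := by positivity
  have ht0 : 0 < t := hN2.trans_le ht
  have h1 : t ^ (-(1 / 2 : ℝ) - j) ≤ (N / 2) ^ (-(1 / 2 : ℝ) - j) :=
    Real.rpow_le_rpow_of_nonpos hN2 ht (by linarith [(Nat.cast_nonneg j : (0:ℝ) ≤ j)])
  refine h1.trans ?_
  rw [show (-(1 / 2 : ℝ) - j) = -((1 / 2 : ℝ) + j) by ring, Real.rpow_neg hN2.le,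
    Real.rpow_add hN2, Real.rpow_natCast, ← Real.sqrt_eq_rpow, Real.sqrt_div' N zero_le_two, div_pow]
  rw [show ((Real.sqrt N / Real.sqrt 2) * (N ^ j / 2 ^ j))⁻¹ = (Real.sqrt 2 * 2 ^ j) * ((Real.sqrt N)⁻¹ / N ^ j) by
    field_simp]
  rw [show (2 : ℝ) ^ (j + 1) * (Real.sqrt N)⁻¹ / N ^ j = (2 * 2 ^ j) * ((Real.sqrt N)⁻¹ / N ^ j) by rw [pow_succ]; ring]
  refine mul_le_mul_of_nonneg_right ?_ (by positivity)
  have : Real.sqrt 2 ≤ 2 := by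
    rw [Real.sqrt_le_left (by norm_num)]; norm_num
  nlinarith [pow_pos (two_pos : (0:ℝ) < 2) j]

/-- **Jets of `ι_N` on `[0.94N, 2.06N]`**: `‖ι_N^{(j)}(t)‖ ≤ j! 2^j (√N)⁻¹/N^j`. [folklore] -/
theorem norm_iteratedDeriv_iotaFun_le {N : ℝ} (hN : 0 < N) {t : ℝ} (ht : 47 / 50 * N ≤ t) (j : ℕ) :
    ‖iteratedDeriv j (fun s : ℝ => ((iotaFun N s : ℝ) : ℂ)) t‖ ≤ (j.factorial : ℝ) * 2 ^ j * (Real.sqrt N)⁻¹ / N ^ j := by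
  rw [iteratedDeriv_ofReal_comp (contDiff_iotaFun hN), Complex.norm_real, Real.norm_eq_abs]
  have ht9 : 9 / 10 * N < t := by linarith
  rw [(iotaFun_eventuallyEq hN ht9).iteratedDeriv_eq]
  have ht0 : 0 < t := by linarith
  refine (norm_iteratedDeriv_inv_two_sqrt_le ht0 j).trans ?_
  have h2 := rpow_neg_half_sub_le hN (t := t) (by linarith) j
  calc (j.factorial : ℝ) / 2 * t ^ (-(1 / 2 : ℝ) - j) ≤ (j.factorial : ℝ) / 2 * (2 ^ (j + 1) * (Real.sqrt N)⁻¹ / N ^ j) := by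
        gcongr
    _ = _ := by rw [pow_succ]; ring

/-- **Jets of `σ_N`** (everywhere): with `Mχ` a bound for the first `p + 1` derivatives of `χ₀`,
`‖σ_N^{(j)}(t)‖ ≤ 2^j Mχ (p! 2^p) (√N)⁻¹ / N^j` for `j ≤ p`. [folklore] -/
theorem norm_iteratedDeriv_sigmaFun_le {N : ℝ} (hN : 0 < N) {p : ℕ} {Mχ : ℝ} (hMχ0 : 0 ≤ Mχ)
    (hMχ : ∀ j ≤ p, ∀ x, |iteratedDeriv j (chi0 : ℝ → ℝ) x| ≤ Mχ) :
    ∀ j ≤ p, ∀ t, ‖iteratedDeriv j (fun s : ℝ => ((sigmaFun N s : ℝ) : ℂ)) t‖ ≤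
      2 ^ p * Mχ * ((p.factorial : ℝ) * 2 ^ p * (Real.sqrt N)⁻¹) / N ^ j := by
  intro j hj t
  have hfun : (fun s : ℝ => ((sigmaFun N s : ℝ) : ℂ)) =
      fun s => (((chi0 : ℝ → ℝ) (N⁻¹ * s) : ℝ) : ℂ) * ((iotaFun N s : ℝ) : ℂ) := by
    funext s; rw [sigmaFun]; push_cast; ring
  rw [hfun]
  by_cases ht : 47 / 50 * N ≤ t ∧ t ≤ 103 / 50 * N
  · -- Leibniz on the interval
    have hχ : ContDiff ℝ ∞ (fun s : ℝ => (((chi0 : ℝ → ℝ) (N⁻¹ * s) : ℝ) : ℂ)) :=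
      ofRealCLM.contDiff.comp (chi0.contDiff.comp (contDiff_const.mul contDiff_id))
    have hι : ContDiff ℝ ∞ (fun s : ℝ => ((iotaFun N s : ℝ) : ℂ)) := ofRealCLM.contDiff.comp (contDiff_iotaFun hN)
    have h := norm_iteratedDeriv_mul_le_of_scaled hχ hι t j (A := Mχ) (B := (p.factorial : ℝ) * 2 ^ p * (Real.sqrt N)⁻¹)
      hMχ0 hN (fun i hi => norm_iteratedDeriv_scaled_le chi0.contDiff hMχ hN i (hi.trans hj) t) (fun i hi => by
        refine (norm_iteratedDeriv_iotaFun_le hN ht.1 i).trans (div_le_div_of_nonneg_right ?_ (by positivity))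
        have hi' : i ≤ p := hi.trans hj
        have hf : (i.factorial : ℝ) ≤ p.factorial := by exact_mod_cast Nat.factorial_le hi'
        have h2 : (2 : ℝ) ^ i ≤ 2 ^ p := pow_le_pow_right₀ (by norm_num) hi'
        gcongr)
    refine h.trans (div_le_div_of_nonneg_right ?_ (by positivity))
    have h2 : (2 : ℝ) ^ j ≤ 2 ^ p := pow_le_pow_right₀ (by norm_num) hj
    have : 0 ≤ Mχ * ((p.factorial : ℝ) * 2 ^ p * (Real.sqrt N)⁻¹) := by positivity
    nlinarith
  · -- off the interval `σ_N` vanishes identically near `t`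
    have hopen : IsOpen (Icc (47 / 50 * N) (103 / 50 * N))ᶜ := isClosed_Icc.isOpen_compl
    have ht' : t ∈ (Icc (47 / 50 * N) (103 / 50 * N))ᶜ := fun h => ht h
    have hEq : Set.EqOn (fun s : ℝ => (((chi0 : ℝ → ℝ) (N⁻¹ * s) : ℝ) : ℂ) * ((iotaFun N s : ℝ) : ℂ))
        (fun _ => (0 : ℂ)) (Icc (47 / 50 * N) (103 / 50 * N))ᶜ := by
      intro s hs
      have hs' : ¬ (47 / 50 * N < s ∧ s < 103 / 50 * N) := fun h => hs ⟨h.1.le, h.2.le⟩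
      have := sigmaFun_eq_zero hN hs'
      rw [sigmaFun] at this
      simp only
      rw [← Complex.ofReal_mul, this]; simp
    rw [hEq.iteratedDeriv_of_isOpen hopen j ht', iteratedDeriv_const]
    split_ifs <;> simp only [norm_zero] <;> positivity


/-! ### The phase of the Fourier coefficients and its non-stationarity -/

/-- `2(√2 − 1)/√0.94 ≤ 7/8`, in the form `4(√2−1)√N (2√(0.94N))⁻¹ ≤ 7/8` (`N > 0`). [folklore] -/
theorem key_numeric {N : ℝ} (hN : 0 < N) :
    4 * (Real.sqrt 2 - 1) * Real.sqrt N * (2 * Real.sqrt (47 / 50 * N))⁻¹ ≤ 7 / 8 := by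
  have hs2 : Real.sqrt 2 ≤ 14143 / 10000 := by
    rw [Real.sqrt_le_left (by norm_num)]; norm_num
  have hs2' : 1 ≤ Real.sqrt 2 := by rw [Real.le_sqrt (by norm_num) (by norm_num)]; norm_num
  have hs94 : (9695 / 10000 : ℝ) ≤ Real.sqrt (47 / 50) := by
    rw [Real.le_sqrt (by norm_num) (by norm_num)]; norm_num
  have hsN : 0 < Real.sqrt N := Real.sqrt_pos.2 hN
  rw [Real.sqrt_mul' _ hN.le]
  have h94pos : 0 < Real.sqrt (47 / 50) := lt_of_lt_of_le (by norm_num) hs94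
  rw [show 4 * (Real.sqrt 2 - 1) * Real.sqrt N * (2 * (Real.sqrt (47 / 50) * Real.sqrt N))⁻¹ =
    2 * (Real.sqrt 2 - 1) / Real.sqrt (47 / 50) by field_simp; ring]
  rw [div_le_iff₀ h94pos]
  nlinarith

/-- For `m₁, m₂ ∼ N`: `|√m₁ − √m₂| ≤ (√2 − 1)√N`. [folklore] -/
theorem abs_sqrt_sub_sqrt_le {N : ℝ} (hN : 0 ≤ N) {m₁ m₂ : ℕ} (h1 : m₁ ∈ dyadic N) (h2 : m₂ ∈ dyadic N) :
    |Real.sqrt m₁ - Real.sqrt m₂| ≤ (Real.sqrt 2 - 1) * Real.sqrt N := by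
  obtain ⟨h1a, h1b⟩ := (mem_dyadic hN).1 h1
  obtain ⟨h2a, h2b⟩ := (mem_dyadic hN).1 h2
  have hlo : ∀ {m : ℕ}, N < m → Real.sqrt N ≤ Real.sqrt m := fun h => Real.sqrt_le_sqrt h.le
  have hhi : ∀ {m : ℕ}, (m : ℝ) ≤ 2 * N → Real.sqrt m ≤ Real.sqrt 2 * Real.sqrt N := fun h => by
    rw [← Real.sqrt_mul (by norm_num)]; exact Real.sqrt_le_sqrt h
  rw [abs_le]
  constructor <;> nlinarith [hlo h1a, hlo h2a, hhi h1b, hhi h2b]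

/-- A rational `a/c` that is not the integer `u` is at distance `≥ 1/c` from it. [folklore] -/
theorem inv_le_abs_sub_of_ne {a u : ℤ} {c : ℕ} (hc : 1 ≤ c) (h : (a : ℝ) / c ≠ u) :
    (c : ℝ)⁻¹ ≤ |(a : ℝ) / c - u| := by
  have hc0 : (0 : ℝ) < c := by exact_mod_cast hc
  have hne : (a - u * c : ℤ) ≠ 0 := by
    intro h0
    apply h
    have : (a : ℝ) = u * c := by exact_mod_cast (sub_eq_zero.1 h0)
    rw [this]; field_simp
  have h1 : (1 : ℝ) ≤ |((a - u * c : ℤ) : ℝ)| := by exact_mod_cast Int.one_le_abs hne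
  rw [show (a : ℝ) / c - u = ((a - u * c : ℤ) : ℝ) / c by push_cast; field_simp, abs_div, abs_of_pos hc0,
    le_div_iff₀ hc0, inv_mul_cancel₀ hc0.ne']
  exact h1

/-- The derivative `Ψ(t) = δ + B σ_N(t)` of the phase `ψ(t) = δ t + B Σ_N(t)`. [folklore] -/
def phaseDeriv (N δ B : ℝ) (t : ℝ) : ℝ := δ + B * sigmaFun N t

/-- The phase `ψ(t) = δ t + B Σ_N(t)`. [folklore] -/
def phaseFun (N δ B : ℝ) (t : ℝ) : ℝ := δ * t + B * smoothSqrt N t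

/-- `ψ' = Ψ`. [folklore] -/
theorem hasDerivAt_phaseFun {N : ℝ} (hN : 0 < N) (δ B t : ℝ) :
    HasDerivAt (phaseFun N δ B) (phaseDeriv N δ B t) t := by
  unfold phaseFun phaseDeriv
  have h1 : HasDerivAt (fun t => δ * t) δ t := by simpa using (hasDerivAt_id t).const_mul δ
  exact h1.add ((hasDerivAt_smoothSqrt hN t).const_mul B)

/-- **Non-stationarity**: if `|B| ≤ 4(√2−1)√N/c`, `1/c ≤ |δ|` then `|Ψ(t)| ≥ |δ|/8` for all `t`.
[cite: DeshouillersIwaniec1982, §5.1 p. 257] -/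
theorem abs_phaseDeriv_ge {N : ℝ} (hN : 0 < N) {c : ℕ} (hc : 1 ≤ c) {δ B : ℝ}
    (hB : |B| ≤ 4 * (Real.sqrt 2 - 1) * Real.sqrt N / c) (hδ : (c : ℝ)⁻¹ ≤ |δ|) (t : ℝ) :
    |δ| / 8 ≤ |phaseDeriv N δ B t| := by
  have hc0 : (0 : ℝ) < c := by exact_mod_cast hc
  have hσ := abs_sigmaFun_le hN t
  have hkey := key_numeric hN
  have hs2' : 1 ≤ Real.sqrt 2 := by rw [Real.le_sqrt (by norm_num) (by norm_num)]; norm_num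
  -- `|B σ| ≤ (7/8)/c ≤ (7/8)|δ|`
  have hBσ : |B * sigmaFun N t| ≤ 7 / 8 * |δ| := by
    rw [abs_mul]
    calc |B| * |sigmaFun N t| ≤ (4 * (Real.sqrt 2 - 1) * Real.sqrt N / c) * (2 * Real.sqrt (47 / 50 * N))⁻¹ :=
          mul_le_mul hB hσ (abs_nonneg _) (by positivity)
      _ = (4 * (Real.sqrt 2 - 1) * Real.sqrt N * (2 * Real.sqrt (47 / 50 * N))⁻¹) * (c : ℝ)⁻¹ := by ring
      _ ≤ 7 / 8 * (c : ℝ)⁻¹ := mul_le_mul_of_nonneg_right hkey (by positivity)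
      _ ≤ 7 / 8 * |δ| := by gcongr
  unfold phaseDeriv
  have := abs_add_le δ (B * sigmaFun N t) |> fun _ => abs_sub_abs_le_abs_sub δ (-(B * sigmaFun N t))
  rw [sub_neg_eq_add, abs_neg] at this
  linarith

/-- The size of `B = 2θ(√m₁ − √m₂)/c`: `|B| ≤ 4(√2−1)√N/c` (`|θ| ≤ 2`, `m₁, m₂ ∼ N`), and hence
`|B| (√N)⁻¹ ≤ 2/c`. [folklore] -/
theorem abs_B_le {N θ : ℝ} (hN : 0 < N) (hθ : |θ| ≤ 2) {c : ℕ} (hc : 1 ≤ c) {m₁ m₂ : ℕ} (h1 : m₁ ∈ dyadic N)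
    (h2 : m₂ ∈ dyadic N) :
    |2 * θ * (Real.sqrt m₁ - Real.sqrt m₂) / c| ≤ 4 * (Real.sqrt 2 - 1) * Real.sqrt N / c ∧
      |2 * θ * (Real.sqrt m₁ - Real.sqrt m₂) / c| * (Real.sqrt N)⁻¹ ≤ 2 / c := by
  have hc0 : (0 : ℝ) < c := by exact_mod_cast hc
  have hsN : 0 < Real.sqrt N := Real.sqrt_pos.2 hN
  have hd := abs_sqrt_sub_sqrt_le hN.le h1 h2
  have hs2 : Real.sqrt 2 ≤ 3 / 2 := by rw [Real.sqrt_le_left (by norm_num)]; norm_num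
  have hs2' : 1 ≤ Real.sqrt 2 := by rw [Real.le_sqrt (by norm_num) (by norm_num)]; norm_num
  have hmain : |2 * θ * (Real.sqrt m₁ - Real.sqrt m₂) / c| ≤ 4 * (Real.sqrt 2 - 1) * Real.sqrt N / c := by
    rw [abs_div, abs_of_pos hc0, abs_mul, abs_mul, abs_two]
    refine div_le_div_of_nonneg_right ?_ hc0.le
    calc 2 * |θ| * |Real.sqrt m₁ - Real.sqrt m₂| ≤ 2 * 2 * ((Real.sqrt 2 - 1) * Real.sqrt N) :=
          mul_le_mul (by linarith) hd (abs_nonneg _) (by norm_num)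
      _ = _ := by ring
  refine ⟨hmain, ?_⟩
  calc |2 * θ * (Real.sqrt m₁ - Real.sqrt m₂) / c| * (Real.sqrt N)⁻¹
      ≤ (4 * (Real.sqrt 2 - 1) * Real.sqrt N / c) * (Real.sqrt N)⁻¹ := mul_le_mul_of_nonneg_right hmain (by positivity)
    _ = 4 * (Real.sqrt 2 - 1) / c := by field_simp
    _ ≤ 2 / c := by
        refine div_le_div_of_nonneg_right ?_ hc0.le
        linarith

/-- **The non-zero Fourier coefficients are negligible** ([DeshouillersIwaniec1982, p. 257]:
"`f̂(u) ≪ N(|A − u|N)^{−p}`"): for every `p` there is `K` such that for `N > 0`, `c ≥ 1`, `|θ| ≤ 2`,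
`m₁, m₂ ∼ N`, integers `a, u` with `a/c ≠ u`, and `δ = a/c − u`, `B = 2θ(√m₁ − √m₂)/c`,
`‖∫ η₀(t/N) e(ψ(t)) dt‖ ≤ K N (|δ| N)^{−p}`, `ψ = δ t + B Σ_N`. [cite: DeshouillersIwaniec1982, §5.1 p. 257] -/
theorem norm_fourierCoeff_le (p : ℕ) :
    ∃ K : ℝ, 0 ≤ K ∧ ∀ (N θ : ℝ) (c : ℕ) (m₁ m₂ : ℕ) (a u : ℤ), 0 < N → 1 ≤ c → |θ| ≤ 2 →
      m₁ ∈ dyadic N → m₂ ∈ dyadic N → (a : ℝ) / c ≠ u →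
      ‖∫ t, (((eta0 : ℝ → ℝ) (N⁻¹ * t) : ℝ) : ℂ) *
          phaseExp (phaseFun N ((a : ℝ) / c - u) (2 * θ * (Real.sqrt m₁ - Real.sqrt m₂) / c)) t‖ ≤
        K * N / (|(a : ℝ) / c - u| * N) ^ p := by
  -- the fixed constants
  obtain ⟨Mη, hMη1, hMη⟩ := exists_jet_bound eta0.contDiff eta0.hasCompactSupport p
  obtain ⟨Mχ, hMχ1, hMχ⟩ := exists_jet_bound chi0.contDiff chi0.hasCompactSupport p
  set Q : ℝ := 16 * (2 ^ p * Mχ * ((p.factorial : ℝ) * 2 ^ p)) with hQ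
  have hQ0 : 0 ≤ Q := by positivity
  obtain ⟨CR, hCR0, hCR⟩ := exists_norm_iteratedDeriv_inv_le p hQ0
  refine ⟨27 / 25 * Mη * (2 ^ p * CR * 8 / (2 * Real.pi)) ^ p, by positivity, ?_⟩
  intro N θ c m₁ m₂ a u hN hc hθ h1 h2 hne
  have hc0 : (0 : ℝ) < c := by exact_mod_cast hc
  set δ : ℝ := (a : ℝ) / c - u with hδ
  set B : ℝ := 2 * θ * (Real.sqrt m₁ - Real.sqrt m₂) / c with hBdef
  have hδc : (c : ℝ)⁻¹ ≤ |δ| := inv_le_abs_sub_of_ne hc hne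
  have hδ0 : 0 < |δ| := lt_of_lt_of_le (by positivity) hδc
  obtain ⟨hB1, hB2⟩ := abs_B_le hN hθ hc h1 h2
  set lam : ℝ := |δ| / 8 with hlam
  have hlam0 : 0 < lam := by positivity
  -- the amplitude
  set h : ℝ → ℂ := fun t => (((eta0 : ℝ → ℝ) (N⁻¹ * t) : ℝ) : ℂ) with hh
  have hhs : ∀ t ∉ Icc (24 / 25 * N) (51 / 25 * N), h t = 0 := by
    intro t ht
    simp only [hh]
    rw [eta0.zero_of_le_dist, Complex.ofReal_zero]
    rw [Real.dist_eq, show (eta0).rOut = 27 / 50 from rfl, inv_mul_eq_div, le_abs]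
    rw [Set.mem_Icc, not_and_or, not_le, not_le] at ht
    rcases ht with ht | ht
    · right
      have : t / N < 24 / 25 := (div_lt_iff₀ hN).2 (by linarith)
      linarith
    · left
      have : 51 / 25 < t / N := (lt_div_iff₀ hN).2 (by linarith)
      linarith
  have hhd : ContDiff ℝ ∞ h := ofRealCLM.contDiff.comp (eta0.contDiff.comp (contDiff_const.mul contDiff_id))
  have hhA : ∀ j ≤ p, ∀ t, ‖iteratedDeriv j h t‖ ≤ Mη / N ^ j := norm_iteratedDeriv_scaled_le eta0.contDiff hMη hN
  -- the phase derivative, as a complex function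
  set Ψ : ℝ → ℝ := phaseDeriv N δ B with hΨ
  set f : ℝ → ℂ := fun t => ((Ψ t : ℝ) : ℂ) with hf
  have hΨcont : Continuous Ψ := continuous_const.add (continuous_const.mul (continuous_sigmaFun hN))
  have hΨsmooth : ContDiff ℝ ∞ Ψ := contDiff_const.add (contDiff_const.mul (contDiff_sigmaFun hN))
  have hfsmooth : ContDiff ℝ ∞ f := ofRealCLM.contDiff.comp hΨsmooth
  have hlow : ∀ t, lam ≤ ‖f t‖ := fun t => by
    rw [hf]; dsimp only; rw [Complex.norm_real, Real.norm_eq_abs]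
    exact abs_phaseDeriv_ge hN hc hB1 hδc t
  have hf0 : ∀ t, f t ≠ 0 := fun t h0 => by have := hlow t; rw [h0, norm_zero] at this; linarith
  -- jets of `f`
  have hder : ∀ j, 1 ≤ j → j ≤ p → ∀ t, ‖iteratedDeriv j f t‖ ≤ Q * lam / N ^ j := by
    intro j hj1 hjp t
    have hfun : f = fun t => ((δ : ℝ) : ℂ) + (B : ℂ) * ((sigmaFun N t : ℝ) : ℂ) := by
      funext t; simp [hf, hΨ, phaseDeriv]
    rw [hfun, iteratedDeriv_const_add, iteratedDeriv_const_mul_field, norm_mul, Complex.norm_real,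
      Real.norm_eq_abs]
    have hσ := norm_iteratedDeriv_sigmaFun_le hN (by linarith) hMχ j hjp t
    calc |B| * ‖iteratedDeriv j (fun s : ℝ => ((sigmaFun N s : ℝ) : ℂ)) t‖
        ≤ |B| * (2 ^ p * Mχ * ((p.factorial : ℝ) * 2 ^ p * (Real.sqrt N)⁻¹) / N ^ j) :=
          mul_le_mul_of_nonneg_left hσ (abs_nonneg _)
      _ = (|B| * (Real.sqrt N)⁻¹) * (2 ^ p * Mχ * ((p.factorial : ℝ) * 2 ^ p)) / N ^ j := by ring
      _ ≤ (2 / c) * (2 ^ p * Mχ * ((p.factorial : ℝ) * 2 ^ p)) / N ^ j := by gcongr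
      _ ≤ (16 * lam) * (2 ^ p * Mχ * ((p.factorial : ℝ) * 2 ^ p)) / N ^ j := by
          gcongr
          rw [hlam, div_eq_mul_inv]
          calc (2 : ℝ) / c = 2 * (c : ℝ)⁻¹ := by rw [div_eq_mul_inv]
            _ ≤ 2 * |δ| := by gcongr
            _ = 16 * (|δ| * 8⁻¹) := by ring
      _ = Q * lam / N ^ j := by rw [hQ]; ring
    · exact hj1
  -- the reciprocal
  set r : ℝ → ℂ := fun t => (f t)⁻¹ with hr
  have hrsmooth : ContDiff ℝ ∞ r := hfsmooth.inv hf0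
  have hrΨ : ∀ t, r t * Ψ t = 1 := fun t => by
    simp only [hr, hf]; exact inv_mul_cancel₀ (hf0 t)
  have hrC : ∀ j ≤ p, ∀ t, ‖iteratedDeriv j r t‖ ≤ CR / (lam * N ^ j) :=
    hCR f lam N hlam0 hN hfsmooth hlow hder
  -- the non-stationary phase bound
  have hψ : ∀ t, HasDerivAt (phaseFun N δ B) (Ψ t) t := hasDerivAt_phaseFun hN δ B
  have hmain := norm_integral_mul_phaseExp_le (α := 24 / 25 * N) (β := 51 / 25 * N) (by nlinarith) hhd hhs hrsmooth
    hψ hΨcont hrΨ (p := p) (by positivity) hCR0 hlam0 hN hhA hrC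
  refine hmain.trans (le_of_eq ?_)
  rw [hlam]
  have hδne : |δ| ≠ 0 := hδ0.ne'
  have hNne : N ≠ 0 := hN.ne'
  rw [show 2 ^ p * CR / (2 * Real.pi * (|δ| / 8) * N) = (2 ^ p * CR * 8 / (2 * Real.pi)) * (|δ| * N)⁻¹ by
    field_simp, mul_pow, inv_pow]
  ring


/-! ### The summand `f(t) = η₀(t/N) e(κt + BΣ_N(t))`, its Fourier transform and Poisson summation -/

/-- `Σ_N` is smooth (its derivative `σ_N` is). [folklore] -/
theorem contDiff_smoothSqrt {N : ℝ} (hN : 0 < N) : ContDiff ℝ ∞ (smoothSqrt N) := by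
  rw [contDiff_infty_iff_deriv]
  have hd : deriv (smoothSqrt N) = sigmaFun N := funext fun t => (hasDerivAt_smoothSqrt hN t).deriv
  exact ⟨fun t => (hasDerivAt_smoothSqrt hN t).differentiableAt, hd ▸ contDiff_sigmaFun hN⟩

/-- The phase `ψ = δt + BΣ_N` is smooth. [folklore] -/
theorem contDiff_phaseFun {N : ℝ} (hN : 0 < N) (δ B : ℝ) : ContDiff ℝ ∞ (phaseFun N δ B) :=
  (contDiff_const.mul contDiff_id).add (contDiff_const.mul (contDiff_smoothSqrt hN))

/-- `e^{2πiψ}` is smooth. [folklore] -/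
theorem contDiff_phaseExp_phaseFun {N : ℝ} (hN : 0 < N) (δ B : ℝ) : ContDiff ℝ ∞ (phaseExp (phaseFun N δ B)) := by
  unfold phaseExp
  exact Complex.contDiff_exp.comp (contDiff_const.mul (ofRealCLM.contDiff.comp (contDiff_phaseFun hN δ B)))

/-- **The summand** `f(t) = η₀(t/N) e(κ t + B Σ_N(t))`. [folklore] -/
def fFun (N κ B : ℝ) (t : ℝ) : ℂ := (((eta0 : ℝ → ℝ) (N⁻¹ * t) : ℝ) : ℂ) * phaseExp (phaseFun N κ B) t

/-- `f` is smooth. [folklore] -/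
theorem contDiff_fFun {N : ℝ} (hN : 0 < N) (κ B : ℝ) : ContDiff ℝ ∞ (fFun N κ B) :=
  (ofRealCLM.contDiff.comp (eta0.contDiff.comp (contDiff_const.mul contDiff_id))).mul (contDiff_phaseExp_phaseFun hN κ B)

/-- `η₀(t/N) = 0` off `[0.96N, 2.04N]`. [folklore] -/
theorem eta0_scaled_eq_zero {N : ℝ} (hN : 0 < N) {t : ℝ} (ht : t ∉ Icc (24 / 25 * N) (51 / 25 * N)) :
    (eta0 : ℝ → ℝ) (N⁻¹ * t) = 0 := by
  rw [eta0.zero_of_le_dist]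
  rw [Real.dist_eq, show (eta0).rOut = 27 / 50 from rfl, inv_mul_eq_div, le_abs]
  rw [Set.mem_Icc, not_and_or, not_le, not_le] at ht
  rcases ht with ht | ht
  · right
    have : t / N < 24 / 25 := (div_lt_iff₀ hN).2 (by linarith)
    linarith
  · left
    have : 51 / 25 < t / N := (lt_div_iff₀ hN).2 (by linarith)
    linarith

/-- `f = 0` off `[0.96N, 2.04N]`. [folklore] -/
theorem fFun_eq_zero {N : ℝ} (hN : 0 < N) (κ B : ℝ) {t : ℝ} (ht : t ∉ Icc (24 / 25 * N) (51 / 25 * N)) :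
    fFun N κ B t = 0 := by
  rw [fFun, eta0_scaled_eq_zero hN ht]; simp

/-- `f` has compact support. [folklore] -/
theorem hasCompactSupport_fFun {N : ℝ} (hN : 0 < N) (κ B : ℝ) : HasCompactSupport (fFun N κ B) :=
  HasCompactSupport.intro (isCompact_Icc (a := 24 / 25 * N) (b := 51 / 25 * N)) fun _ ht => fFun_eq_zero hN κ B ht

/-- **Values of `f`**: `f(t) = η₀(t/N) exp(2πi(κt + B√t))` everywhere (on the support `Σ_N = √`, off it
both sides vanish). [folklore] -/
theorem fFun_eq {N : ℝ} (hN : 0 < N) (κ B t : ℝ) :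
    fFun N κ B t = (((eta0 : ℝ → ℝ) (N⁻¹ * t) : ℝ) : ℂ) * Complex.exp (2 * Real.pi * Complex.I * (κ * t + B * Real.sqrt t : ℝ)) := by
  by_cases ht : t ∈ Icc (24 / 25 * N) (51 / 25 * N)
  · rw [fFun, phaseExp, phaseFun, smoothSqrt_eq_sqrt hN ht.1 ht.2]
  · rw [fFun, eta0_scaled_eq_zero hN ht]; simp

/-- **The Fourier transform of `f`** at `u`: `𝓕f(u) = ∫ η₀(t/N) e(ψ_u(t)) dt` with the phase
`ψ_u = (κ − u)t + BΣ_N`. [folklore] -/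
theorem fourier_fFun_eq (N κ B u : ℝ) :
    𝓕 (fFun N κ B) u = ∫ t, (((eta0 : ℝ → ℝ) (N⁻¹ * t) : ℝ) : ℂ) * phaseExp (phaseFun N (κ - u) B) t := by
  rw [Real.fourier_real_eq]
  refine integral_congr_ae (Eventually.of_forall fun t => ?_)
  simp only [Circle.smul_def, smul_eq_mul, fFun, phaseExp, phaseFun, Real.fourierChar_apply]
  rw [mul_left_comm, ← Complex.exp_add]
  congr 1
  congr 1; push_cast; ring

/-- **Poisson summation for `f`, finite form**: `∑_{0 ≤ n ≤ L} f(n) = ∑_{u ∈ ℤ} 𝓕f(u)` whenever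
`L ≥ 2.04N`. [folklore] -/
theorem sum_fFun_eq_tsum {N : ℝ} (hN : 0 < N) (κ B : ℝ) {L : ℕ} (hL : 51 / 25 * N ≤ L) :
    ∑ n ∈ Finset.range (L + 1), fFun N κ B n = ∑' u : ℤ, 𝓕 (fFun N κ B) u := by
  have h := FriedlanderIwaniecPrimes.tsum_arithProg_eq_tsum_fourier (contDiff_fFun hN κ B)
    (hasCompactSupport_fFun hN κ B) one_pos 0
  simp only [Int.cast_zero, Nat.cast_one, one_mul, zero_add, zero_mul, div_one,
    inv_one] at h
  have hR : ∑' k : ℤ, (𝐞 (0 : ℝ) : ℂ) * 𝓕 (fFun N κ B) k = ∑' k : ℤ, 𝓕 (fFun N κ B) k :=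
    tsum_congr fun k => by simp
  rw [hR] at h
  rw [← h]
  -- the `ℤ`-sum is finitely supported on `0 ≤ n ≤ L`
  have hzero : ∀ n : ℤ, n ∉ (Finset.range (L + 1)).map Nat.castEmbedding → fFun N κ B n = 0 := by
    intro n hn
    apply fFun_eq_zero hN
    intro hmem
    apply hn
    rw [Finset.mem_map]
    have hn0 : 0 ≤ n := by
      have : (0 : ℝ) ≤ n := le_trans (by positivity) hmem.1
      exact_mod_cast this
    obtain ⟨m, rfl⟩ := Int.eq_ofNat_of_zero_le hn0
    refine ⟨m, Finset.mem_range.2 (Nat.lt_succ_of_le ?_), rfl⟩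
    have : (m : ℝ) ≤ L := by
      have := hmem.2; push_cast at this; linarith
    exact_mod_cast this
  rw [tsum_eq_sum (s := (Finset.range (L + 1)).map Nat.castEmbedding) (fun n hn => hzero n hn), Finset.sum_map]
  simp

/-- **The Fourier coefficients are summable** (decay `O(u⁻²)`). [folklore] -/
theorem summable_fourier_fFun {N : ℝ} (hN : 0 < N) (κ B : ℝ) : Summable fun u : ℤ => 𝓕 (fFun N κ B) u := by
  have := FriedlanderIwaniecPrimes.summable_fourier_div (contDiff_fFun hN κ B) (hasCompactSupport_fFun hN κ B) one_pos
  simpa using this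


/-! ### The error of Poisson summation: all frequencies but `u = 0, a = 0` -/

/-- `∑_{u ∈ ℤ} u⁻² ≤ 4` (in Lean `0⁻² = 0`, so the term `u = 0` contributes nothing). [folklore] -/
theorem tsum_inv_sq_int_le : HasSum (fun u : ℤ => ((u : ℝ) ^ 2)⁻¹) (Real.pi ^ 2 / 6 + Real.pi ^ 2 / 6) ∧
    Real.pi ^ 2 / 6 + Real.pi ^ 2 / 6 ≤ 4 := by
  constructor
  · have h1 : HasSum (fun n : ℕ => ((((n : ℤ) : ℝ)) ^ 2)⁻¹) (Real.pi ^ 2 / 6) := by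
      have := hasSum_zeta_two
      refine this.congr_fun fun n => ?_
      push_cast; rw [one_div]
    have h2 : HasSum (fun n : ℕ => ((((-(n + 1 : ℤ) : ℤ) : ℝ)) ^ 2)⁻¹) (Real.pi ^ 2 / 6) := by
      have := (hasSum_nat_add_iff' 1).2 hasSum_zeta_two
      simp only [Finset.range_one, Finset.sum_singleton, Nat.cast_zero, ne_eq, OfNat.ofNat_ne_zero,
        not_false_eq_true, zero_pow, div_zero, sub_zero] at this
      refine this.congr_fun fun n => ?_
      push_cast; rw [one_div, neg_sq]
    exact HasSum.of_nat_of_neg_add_one h1 h2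
  · have := Real.pi_lt_d2; have := Real.pi_pos; nlinarith

/-- Frequencies `u ≠ 0` against a rational `a/c` with `|a| < c`: `1/(|a/c − u|N)^p ≤ 2^p c^p u⁻²/N^p`
(`p ≥ 2`, `N > 0`). [folklore] -/
theorem inv_pow_freq_le {a u : ℤ} {c : ℕ} (hc : 1 ≤ c) (ha : |a| < c) (hu : u ≠ 0) {p : ℕ} (hp : 2 ≤ p)
    {N : ℝ} (hN : 0 < N) :
    ((|(a : ℝ) / c - u| * N) ^ p)⁻¹ ≤ 2 ^ p * (c : ℝ) ^ p * ((u : ℝ) ^ 2)⁻¹ / N ^ p := by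
  have hc0 : (0 : ℝ) < c := by exact_mod_cast hc
  have hκ : |(a : ℝ) / c| < 1 := by
    rw [abs_div, abs_of_pos hc0, div_lt_one hc0]; exact_mod_cast ha
  have hu1 : (1 : ℝ) ≤ |(u : ℝ)| := by exact_mod_cast Int.one_le_abs hu
  have hne : (a : ℝ) / c ≠ u := fun h => by
    rw [h] at hκ
    have : |(u : ℝ)| < 1 := hκ
    linarith
  have hlow := inv_le_abs_sub_of_ne hc hne
  have hδ0 : 0 < |(a : ℝ) / c - u| := lt_of_lt_of_le (by positivity) hlow
  -- `|a/c − u| ≥ max(1/c, |u|/2)`, hence `|a/c − u| c ≥ |u|/2` in all cases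
  have hkey : |(u : ℝ)| / 2 ≤ |(a : ℝ) / c - u| * c := by
    rcases le_or_gt 2 |(u : ℝ)| with h2 | h2
    · have : |(u : ℝ)| - |(a : ℝ) / c| ≤ |(a : ℝ) / c - u| := by
        have := abs_sub_abs_le_abs_sub (u : ℝ) ((a : ℝ) / c); rw [abs_sub_comm] at this; linarith
      have hc1 : (1 : ℝ) ≤ c := by exact_mod_cast hc
      nlinarith
    · -- `|u| = 1`
      have hu_eq : |(u : ℝ)| = 1 := by
        have h3 : |u| < 2 := by
          have h' : ((|u| : ℤ) : ℝ) < 2 := by rw [Int.cast_abs]; exact h2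
          exact_mod_cast h'
        have : |u| = 1 := by have := Int.one_le_abs hu; omega
        rw [← Int.cast_abs]; exact_mod_cast this
      rw [hu_eq]
      have := mul_le_mul_of_nonneg_right hlow hc0.le
      rw [inv_mul_cancel₀ hc0.ne'] at this
      linarith
  -- conclude
  rw [mul_pow, mul_inv, div_eq_mul_inv _ (N ^ p)]
  refine mul_le_mul_of_nonneg_right ?_ (by positivity)
  rw [← one_div, div_le_iff₀ (pow_pos hδ0 p)]
  have hu2 : (0 : ℝ) < (u : ℝ) ^ 2 := by positivity
  rw [show 2 ^ p * (c : ℝ) ^ p * ((u : ℝ) ^ 2)⁻¹ * |(a : ℝ) / c - u| ^ p =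
    (2 * (|(a : ℝ) / c - u| * c)) ^ p / (u : ℝ) ^ 2 by rw [mul_pow, mul_pow]; field_simp]
  rw [le_div_iff₀ hu2, one_mul]
  calc (u : ℝ) ^ 2 = |(u : ℝ)| ^ 2 := (sq_abs _).symm
    _ ≤ |(u : ℝ)| ^ p := pow_le_pow_right₀ hu1 hp
    _ ≤ (2 * (|(a : ℝ) / c - u| * c)) ^ p := pow_le_pow_left₀ (abs_nonneg _) (by linarith) p

/-- **The sum of the non-trivial Fourier coefficients** ([DeshouillersIwaniec1982, p. 257:
"`∑_{u ≠ A} f̂(u) ≪ N(c/N)^p ≪ c^{-1}`"]): for `p ≥ 2` there is `K₁` such that for `N > 0`, `c ≥ 1`,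
`|θ| ≤ 2`, `m₁, m₂ ∼ N`, `|a| < c`, with `κ = a/c`, `B = 2θ(√m₁ − √m₂)/c` and `L ≥ 2.04N`,
`‖∑_{n ≤ L} f(n) − [a = 0] 𝓕f(0)‖ ≤ K₁ c^p N^{1−p}`. [cite: DeshouillersIwaniec1982, §5.1 p. 257] -/
theorem norm_sum_fFun_sub_le {p : ℕ} (hp : 2 ≤ p) :
    ∃ K₁ : ℝ, 0 ≤ K₁ ∧ ∀ (N θ : ℝ) (c : ℕ) (m₁ m₂ : ℕ) (a : ℤ) (L : ℕ), 0 < N → 1 ≤ c → |θ| ≤ 2 →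
      m₁ ∈ dyadic N → m₂ ∈ dyadic N → |a| < c → 51 / 25 * N ≤ L →
      ‖(∑ n ∈ Finset.range (L + 1), fFun N ((a : ℝ) / c) (2 * θ * (Real.sqrt m₁ - Real.sqrt m₂) / c) n) -
        (if a = 0 then 𝓕 (fFun N ((a : ℝ) / c) (2 * θ * (Real.sqrt m₁ - Real.sqrt m₂) / c)) 0 else 0)‖ ≤
        K₁ * (c : ℝ) ^ p * N ^ (1 - (p : ℝ)) := by
  obtain ⟨K, hK0, hK⟩ := norm_fourierCoeff_le p
  refine ⟨K + 4 * (2 ^ p * K), by positivity, ?_⟩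
  intro N θ c m₁ m₂ a L hN hc hθ h1 h2 ha hL
  have hc0 : (0 : ℝ) < c := by exact_mod_cast hc
  set κ : ℝ := (a : ℝ) / c with hκ
  set B : ℝ := 2 * θ * (Real.sqrt m₁ - Real.sqrt m₂) / c with hB
  set F : ℤ → ℂ := fun u => 𝓕 (fFun N κ B) u with hF
  have hsum : Summable F := summable_fourier_fFun hN κ B
  have hF0 : F 0 = 𝓕 (fFun N κ B) 0 := by simp [hF]
  rw [sum_fFun_eq_tsum hN κ B hL, hsum.tsum_eq_add_tsum_ite 0, ← hF0]
  -- the frequency bound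
  have hfreq : ∀ u : ℤ, (a : ℝ) / c ≠ u → ‖F u‖ ≤ K * N / (|(a : ℝ) / c - u| * N) ^ p := by
    intro u hu
    simp only [hF]
    rw [fourier_fFun_eq]
    exact hK N θ c m₁ m₂ a u hN hc hθ h1 h2 hu
  have hNp : K * N / N ^ p * (c : ℝ) ^ p ≤ K * (c : ℝ) ^ p * N ^ (1 - (p : ℝ)) := by
    rw [Real.rpow_sub hN, Real.rpow_one, Real.rpow_natCast]
    exact le_of_eq (by field_simp)
  -- the term `u = 0`
  have h0 : ‖F 0 - (if a = 0 then F 0 else 0)‖ ≤ K * (c : ℝ) ^ p * N ^ (1 - (p : ℝ)) := by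
    by_cases ha0 : a = 0
    · rw [if_pos ha0, sub_self, norm_zero]; positivity
    · rw [if_neg ha0, sub_zero]
      have hne : (a : ℝ) / c ≠ ((0 : ℤ) : ℝ) := by
        rw [Int.cast_zero]; exact div_ne_zero (by exact_mod_cast ha0) hc0.ne'
      refine (hfreq 0 hne).trans ?_
      rw [Int.cast_zero, sub_zero]
      have hlow : (c : ℝ)⁻¹ ≤ |(a : ℝ) / c| := by
        have := inv_le_abs_sub_of_ne hc hne; rwa [Int.cast_zero, sub_zero] at this
      calc K * N / (|(a : ℝ) / c| * N) ^ p ≤ K * N / ((c : ℝ)⁻¹ * N) ^ p := by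
            gcongr
        _ = K * N / N ^ p * (c : ℝ) ^ p := by rw [mul_pow, inv_pow]; field_simp
        _ ≤ _ := hNp
  -- the terms `u ≠ 0`
  have hterm : ∀ u : ℤ, ‖(if u = 0 then (0 : ℂ) else F u)‖ ≤
      (2 ^ p * K * (c : ℝ) ^ p * N ^ (1 - (p : ℝ))) * ((u : ℝ) ^ 2)⁻¹ := by
    intro u
    by_cases hu : u = 0
    · rw [if_pos hu, hu]; simp
    · rw [if_neg hu]
      have hκ1 : |(a : ℝ) / c| < 1 := by
        rw [abs_div, abs_of_pos hc0, div_lt_one hc0]; exact_mod_cast ha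
      have hne : (a : ℝ) / c ≠ u := fun h => by
        rw [h] at hκ1
        have h1' : (1 : ℝ) ≤ |(u : ℝ)| := by exact_mod_cast Int.one_le_abs hu
        have : |(u : ℝ)| < 1 := hκ1
        linarith
      refine (hfreq u hne).trans ?_
      rw [div_eq_mul_inv]
      have hinv := inv_pow_freq_le hc ha hu hp hN
      calc K * N * ((|(a : ℝ) / c - u| * N) ^ p)⁻¹ ≤ K * N * (2 ^ p * (c : ℝ) ^ p * ((u : ℝ) ^ 2)⁻¹ / N ^ p) :=
            mul_le_mul_of_nonneg_left hinv (by positivity)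
        _ = 2 ^ p * (K * N / N ^ p * (c : ℝ) ^ p) * ((u : ℝ) ^ 2)⁻¹ := by ring
        _ ≤ 2 ^ p * (K * (c : ℝ) ^ p * N ^ (1 - (p : ℝ))) * ((u : ℝ) ^ 2)⁻¹ := by gcongr
        _ = _ := by ring
  obtain ⟨hS, h4⟩ := tsum_inv_sq_int_le
  have hsum' : Summable fun u : ℤ => (if u = 0 then (0 : ℂ) else F u) := by
    refine Summable.of_norm_bounded (g := fun u : ℤ => (2 ^ p * K * (c : ℝ) ^ p * N ^ (1 - (p : ℝ))) * ((u : ℝ) ^ 2)⁻¹)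
      (hS.summable.mul_left _) hterm
  have htail : ‖∑' u : ℤ, (if u = 0 then (0 : ℂ) else F u)‖ ≤
      (2 ^ p * K * (c : ℝ) ^ p * N ^ (1 - (p : ℝ))) * 4 := by
    refine (norm_tsum_le_tsum_norm hsum'.norm).trans ?_
    refine (hsum'.norm.tsum_le_tsum hterm (hS.summable.mul_left _)).trans ?_
    rw [tsum_mul_left, hS.tsum_eq]
    exact mul_le_mul_of_nonneg_left h4 (by positivity)
  calc ‖F 0 + ∑' u : ℤ, (if u = 0 then (0 : ℂ) else F u) - (if a = 0 then F 0 else 0)‖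
      = ‖(F 0 - (if a = 0 then F 0 else 0)) + ∑' u : ℤ, (if u = 0 then (0 : ℂ) else F u)‖ := by ring_nf
    _ ≤ ‖F 0 - (if a = 0 then F 0 else 0)‖ + ‖∑' u : ℤ, (if u = 0 then (0 : ℂ) else F u)‖ := norm_add_le _ _
    _ ≤ K * (c : ℝ) ^ p * N ^ (1 - (p : ℝ)) + (2 ^ p * K * (c : ℝ) ^ p * N ^ (1 - (p : ℝ))) * 4 := add_le_add h0 htail
    _ = (K + 4 * (2 ^ p * K)) * (c : ℝ) ^ p * N ^ (1 - (p : ℝ)) := by ring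


/-! ### The zero frequency `∫ η₀(t/N) e(BΣ_N(t)) dt` -/

/-- **Trivial bound for the central Fourier coefficient**: `‖𝓕f(0)‖ ≤ 1.08 N`. [folklore] -/
theorem norm_fourier_fFun_zero_le {N : ℝ} (hN : 0 < N) (κ B : ℝ) : ‖𝓕 (fFun N κ B) 0‖ ≤ 27 / 25 * N := by
  rw [fourier_fFun_eq]
  have hbound : ∀ t, ‖(((eta0 : ℝ → ℝ) (N⁻¹ * t) : ℝ) : ℂ) * phaseExp (phaseFun N (κ - 0) B) t‖ ≤
      (Icc (24 / 25 * N) (51 / 25 * N)).indicator (1 : ℝ → ℝ) t := by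
    intro t
    rw [norm_mul, norm_phaseExp, mul_one, Complex.norm_real, Real.norm_eq_abs, abs_of_nonneg eta0.nonneg]
    by_cases ht : t ∈ Icc (24 / 25 * N) (51 / 25 * N)
    · rw [Set.indicator_of_mem ht, Pi.one_apply]; exact eta0.le_one
    · rw [Set.indicator_of_notMem ht, eta0_scaled_eq_zero hN ht]
  have hint : Integrable ((Icc (24 / 25 * N) (51 / 25 * N)).indicator (1 : ℝ → ℝ)) :=
    (continuousOn_const.integrableOn_compact isCompact_Icc).integrable_indicator measurableSet_Icc
  calc ‖∫ t, (((eta0 : ℝ → ℝ) (N⁻¹ * t) : ℝ) : ℂ) * phaseExp (phaseFun N (κ - 0) B) t‖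
      ≤ ∫ t, (Icc (24 / 25 * N) (51 / 25 * N)).indicator (1 : ℝ → ℝ) t :=
        norm_integral_le_of_norm_le hint (Eventually.of_forall hbound)
    _ = 27 / 25 * N := by
        rw [integral_indicator_one measurableSet_Icc, Real.volume_real_Icc_of_le (by nlinarith)]; ring

/-- The derivative of the scaled cutoff `η₀(·/N)` vanishes off `[0.96N, 2.04N]`. [folklore] -/
theorem deriv_eta0_scaled_eq_zero {N : ℝ} (hN : 0 < N) {t : ℝ} (ht : t ∉ Icc (24 / 25 * N) (51 / 25 * N)) :
    deriv (eta0 : ℝ → ℝ) (N⁻¹ * t) = 0 := by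
  have hx : (eta0).rOut < dist (N⁻¹ * t) (3 / 2) := by
    rw [Real.dist_eq, show (eta0).rOut = 27 / 50 from rfl, inv_mul_eq_div, lt_abs]
    rw [Set.mem_Icc, not_and_or, not_le, not_le] at ht
    rcases ht with ht | ht
    · right
      have : t / N < 24 / 25 := (div_lt_iff₀ hN).2 (by linarith)
      linarith
    · left
      have : 51 / 25 < t / N := (lt_div_iff₀ hN).2 (by linarith)
      linarith
  have hev : (eta0 : ℝ → ℝ) =ᶠ[𝓝 (N⁻¹ * t)] fun _ => 0 := by
    have ho : IsOpen {y : ℝ | (eta0).rOut < dist y (3 / 2)} :=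
      isOpen_lt continuous_const (continuous_id.dist continuous_const)
    exact Filter.eventuallyEq_of_mem (ho.mem_nhds hx) fun y hy => eta0.zero_of_le_dist (le_of_lt hy)
  rw [hev.deriv_eq, deriv_const]

/-- **The zero frequency after one integration by parts** ([DeshouillersIwaniec1982, p. 257:
"`∫ f(ξ)dξ ≪ cN θ⁻¹ |m₁ − m₂|⁻¹`"], first half): for `B ≠ 0`, `‖∫ η₀(t/N) e(BΣ_N(t)) dt‖ ≤ C₀ √N/|B|`,
integrating by parts once with `u = η₀(t/N)·2Σ_N(t)/B`, `dv = d e(BΣ_N(t))`.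
[cite: DeshouillersIwaniec1982, §5.1 p. 257] -/
theorem norm_fourier_fFun_zero_le_div : ∃ C₀ : ℝ, 0 ≤ C₀ ∧ ∀ (N B : ℝ), 0 < N → B ≠ 0 →
    ‖𝓕 (fFun N 0 B) 0‖ ≤ C₀ * Real.sqrt N / |B| := by
  obtain ⟨M, hM1, hM⟩ := exists_jet_bound eta0.contDiff eta0.hasCompactSupport 1
  have hM0 : 0 ≤ M := by linarith
  refine ⟨3 * M + 2, by positivity, fun N B hN hB => ?_⟩
  rw [fourier_fFun_eq, sub_zero]
  have hsN : 0 < Real.sqrt N := Real.sqrt_pos.2 hN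
  have hη : ContDiff ℝ ∞ (eta0 : ℝ → ℝ) := eta0.contDiff
  -- the players
  set g : ℝ → ℝ := fun t => (eta0 : ℝ → ℝ) (N⁻¹ * t) * (2 * smoothSqrt N t / B) with hg
  set g' : ℝ → ℝ := fun t => deriv (eta0 : ℝ → ℝ) (N⁻¹ * t) * N⁻¹ * (2 * smoothSqrt N t / B) +
    (eta0 : ℝ → ℝ) (N⁻¹ * t) * (2 * sigmaFun N t / B) with hg'
  set u : ℝ → ℂ := fun t => ((g t : ℝ) : ℂ) with hu
  set E : ℝ → ℂ := phaseExp (phaseFun N 0 B) with hE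
  have hψ : ∀ t, HasDerivAt (phaseFun N 0 B) (phaseDeriv N 0 B t) t := hasDerivAt_phaseFun hN 0 B
  have hEc : Continuous E := continuous_phaseExp hψ
  have hE' : ∀ t, HasDerivAt E (2 * Real.pi * Complex.I * phaseDeriv N 0 B t * E t) t := hasDerivAt_phaseExp hψ
  have hnE : ∀ t, ‖E t‖ = 1 := norm_phaseExp _
  have hΨc : Continuous (phaseDeriv N 0 B) := continuous_const.add (continuous_const.mul (continuous_sigmaFun hN))
  -- derivative of `g` and of `u`
  have hg_der : ∀ t, HasDerivAt g (g' t) t := by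
    intro t
    have hd : HasDerivAt (eta0 : ℝ → ℝ) (deriv (eta0 : ℝ → ℝ) (N⁻¹ * t)) (N⁻¹ * t) :=
      ((hη.differentiable (by simp)) _).hasDerivAt
    have h1 : HasDerivAt (fun s => (eta0 : ℝ → ℝ) (N⁻¹ * s)) (deriv (eta0 : ℝ → ℝ) (N⁻¹ * t) * N⁻¹) t := by
      have := hd.comp t ((hasDerivAt_id t).const_mul N⁻¹)
      rw [mul_one] at this
      exact this
    have h2 : HasDerivAt (fun s => 2 * smoothSqrt N s / B) (2 * sigmaFun N t / B) t :=
      ((hasDerivAt_smoothSqrt hN t).const_mul 2).div_const B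
    exact h1.mul h2
  have hu' : ∀ t, HasDerivAt u ((g' t : ℝ) : ℂ) t := fun t => (hg_der t).ofReal_comp
  -- supports
  have hg_supp : ∀ t ∉ Icc (24 / 25 * N) (51 / 25 * N), g t = 0 := fun t ht => by
    simp [hg, eta0_scaled_eq_zero hN ht]
  have hg'_supp : ∀ t ∉ Icc (24 / 25 * N) (51 / 25 * N), g' t = 0 := fun t ht => by
    simp [hg', eta0_scaled_eq_zero hN ht, deriv_eta0_scaled_eq_zero hN ht]
  have hu_cs : HasCompactSupport u :=
    HasCompactSupport.intro (isCompact_Icc (a := 24 / 25 * N) (b := 51 / 25 * N)) fun t ht => by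
      simp [hu, hg_supp t ht]
  have hu'_cs : HasCompactSupport (fun t => ((g' t : ℝ) : ℂ)) :=
    HasCompactSupport.intro (isCompact_Icc (a := 24 / 25 * N) (b := 51 / 25 * N)) fun t ht => by
      simp [hg'_supp t ht]
  -- continuity
  have hg_cont : Continuous g := continuous_iff_continuousAt.2 fun t => (hg_der t).continuousAt
  have hg'_cont : Continuous g' := by
    have h1 : Continuous fun t => deriv (eta0 : ℝ → ℝ) (N⁻¹ * t) :=
      (hη.continuous_deriv (by exact_mod_cast le_top)).comp (continuous_const.mul continuous_id)
    have h2 : Continuous fun t => (eta0 : ℝ → ℝ) (N⁻¹ * t) := eta0.continuous.comp (continuous_const.mul continuous_id)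
    exact ((h1.mul continuous_const).mul ((continuous_const.mul (contDiff_smoothSqrt hN).continuous).div_const _)).add
      (h2.mul ((continuous_const.mul (continuous_sigmaFun hN)).div_const _))
  -- integration by parts
  have hi1 : Integrable (fun t => u t * (2 * Real.pi * Complex.I * phaseDeriv N 0 B t * E t)) :=
    ((Complex.continuous_ofReal.comp hg_cont).mul
      ((continuous_const.mul (Complex.continuous_ofReal.comp hΨc)).mul hEc)).integrable_of_hasCompactSupport hu_cs.mul_right
  have hi2 : Integrable (fun t => ((g' t : ℝ) : ℂ) * E t) :=
    ((Complex.continuous_ofReal.comp hg'_cont).mul hEc).integrable_of_hasCompactSupport hu'_cs.mul_right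
  have hi3 : Integrable (fun t => u t * E t) :=
    ((Complex.continuous_ofReal.comp hg_cont).mul hEc).integrable_of_hasCompactSupport hu_cs.mul_right
  have hibp := integral_mul_deriv_eq_deriv_mul_of_integrable (fun x _ => hu' x) (fun x _ => hE' x) hi1 hi2 hi3
  -- `u E' = 2πi η₀(t/N) E`
  have hkey : ∀ t, u t * (2 * Real.pi * Complex.I * phaseDeriv N 0 B t * E t) =
      (2 * Real.pi * Complex.I) * ((((eta0 : ℝ → ℝ) (N⁻¹ * t) : ℝ) : ℂ) * E t) := by
    intro t
    have hreal : g t * phaseDeriv N 0 B t = (eta0 : ℝ → ℝ) (N⁻¹ * t) := by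
      by_cases ht : t ∈ Icc (24 / 25 * N) (51 / 25 * N)
      · have ht0 : 0 < t := lt_of_lt_of_le (by positivity) ht.1
        have hst : Real.sqrt t ≠ 0 := (Real.sqrt_pos.2 ht0).ne'
        simp only [hg, phaseDeriv, smoothSqrt_eq_sqrt hN ht.1 ht.2, sigmaFun_eq hN ht.1 ht.2, zero_add]
        have h2 : 2 * Real.sqrt t / B * (B * (2 * Real.sqrt t)⁻¹) = 1 := by field_simp
        rw [mul_assoc, h2, mul_one]
      · simp [hg, eta0_scaled_eq_zero hN ht]
    simp only [hu]
    rw [← hreal]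
    push_cast
    ring
  have hlhs : ∫ t, u t * (2 * Real.pi * Complex.I * phaseDeriv N 0 B t * E t) =
      (2 * Real.pi * Complex.I) * ∫ t, (((eta0 : ℝ → ℝ) (N⁻¹ * t) : ℝ) : ℂ) * E t := by
    rw [← integral_const_mul]
    exact integral_congr_ae (Eventually.of_forall hkey)
  rw [hlhs] at hibp
  have h2π : (2 * Real.pi * Complex.I : ℂ) ≠ 0 := by simp [Real.pi_ne_zero, Complex.I_ne_zero]
  have hI : ∫ t, (((eta0 : ℝ → ℝ) (N⁻¹ * t) : ℝ) : ℂ) * E t =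
      -(2 * Real.pi * Complex.I)⁻¹ * ∫ t, ((g' t : ℝ) : ℂ) * E t := by
    calc ∫ t, (((eta0 : ℝ → ℝ) (N⁻¹ * t) : ℝ) : ℂ) * E t
        = (2 * Real.pi * Complex.I)⁻¹ * ((2 * Real.pi * Complex.I) *
            ∫ t, (((eta0 : ℝ → ℝ) (N⁻¹ * t) : ℝ) : ℂ) * E t) := by
          rw [← mul_assoc, inv_mul_cancel₀ h2π, one_mul]
      _ = (2 * Real.pi * Complex.I)⁻¹ * -∫ t, ((g' t : ℝ) : ℂ) * E t := by rw [hibp]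
      _ = _ := by ring
  -- the bound for `∫ |g'|`
  set K : ℝ := (3 * M + 2) / (|B| * Real.sqrt N) with hK
  have hK0 : 0 ≤ K := by positivity
  have hg'_bound : ∀ t, ‖((g' t : ℝ) : ℂ) * E t‖ ≤ (Icc (24 / 25 * N) (51 / 25 * N)).indicator (fun _ => K) t := by
    intro t
    rw [norm_mul, hnE, mul_one, Complex.norm_real, Real.norm_eq_abs]
    by_cases ht : t ∈ Icc (24 / 25 * N) (51 / 25 * N)
    · rw [Set.indicator_of_mem ht]
      have h1 : |deriv (eta0 : ℝ → ℝ) (N⁻¹ * t)| ≤ M := by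
        have := hM 1 le_rfl (N⁻¹ * t); rwa [iteratedDeriv_one] at this
      have h2 : |smoothSqrt N t| ≤ 3 / 2 * Real.sqrt N := by
        rw [smoothSqrt_eq_sqrt hN ht.1 ht.2, abs_of_nonneg (Real.sqrt_nonneg _)]
        calc Real.sqrt t ≤ Real.sqrt (51 / 25 * N) := Real.sqrt_le_sqrt ht.2
          _ ≤ Real.sqrt ((3 / 2 * Real.sqrt N) ^ 2) :=
              Real.sqrt_le_sqrt (by nlinarith [Real.sq_sqrt hN.le])
          _ = 3 / 2 * Real.sqrt N := Real.sqrt_sq (by positivity)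
      have h3 : |(eta0 : ℝ → ℝ) (N⁻¹ * t)| ≤ 1 := by rw [abs_of_nonneg eta0.nonneg]; exact eta0.le_one
      have h4 : |sigmaFun N t| ≤ (Real.sqrt N)⁻¹ := by
        refine (abs_sigmaFun_le hN t).trans ?_
        rw [inv_le_inv₀ (by positivity) hsN]
        calc Real.sqrt N ≤ Real.sqrt ((2 * Real.sqrt (47 / 50 * N)) ^ 2) :=
              Real.sqrt_le_sqrt (by nlinarith [Real.sq_sqrt (show (0 : ℝ) ≤ 47 / 50 * N by positivity)])
          _ = 2 * Real.sqrt (47 / 50 * N) := Real.sqrt_sq (by positivity)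
      have hNinv : (N : ℝ)⁻¹ = (Real.sqrt N)⁻¹ * (Real.sqrt N)⁻¹ := by
        rw [← mul_inv, Real.mul_self_sqrt hN.le]
      calc |g' t| ≤ |deriv (eta0 : ℝ → ℝ) (N⁻¹ * t) * N⁻¹ * (2 * smoothSqrt N t / B)| +
            |(eta0 : ℝ → ℝ) (N⁻¹ * t) * (2 * sigmaFun N t / B)| := abs_add_le _ _
        _ = |deriv (eta0 : ℝ → ℝ) (N⁻¹ * t)| * N⁻¹ * (2 * |smoothSqrt N t| / |B|) +
            |(eta0 : ℝ → ℝ) (N⁻¹ * t)| * (2 * |sigmaFun N t| / |B|) := by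
            simp only [abs_mul, abs_div, abs_inv, abs_of_pos hN, abs_two]
        _ ≤ M * N⁻¹ * (2 * (3 / 2 * Real.sqrt N) / |B|) + 1 * (2 * (Real.sqrt N)⁻¹ / |B|) := by gcongr
        _ = K := by rw [hK, hNinv]; field_simp
    · rw [Set.indicator_of_notMem ht, hg'_supp t ht, abs_zero]
  have hintK : Integrable ((Icc (24 / 25 * N) (51 / 25 * N)).indicator (fun _ => K)) :=
    (continuousOn_const.integrableOn_compact isCompact_Icc).integrable_indicator measurableSet_Icc
  have hnorm : ‖∫ t, ((g' t : ℝ) : ℂ) * E t‖ ≤ K * (27 / 25 * N) := by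
    calc ‖∫ t, ((g' t : ℝ) : ℂ) * E t‖ ≤ ∫ t, (Icc (24 / 25 * N) (51 / 25 * N)).indicator (fun _ => K) t :=
          norm_integral_le_of_norm_le hintK (Eventually.of_forall hg'_bound)
      _ = K * (27 / 25 * N) := by
          rw [integral_indicator_const K measurableSet_Icc, Real.volume_real_Icc_of_le (by nlinarith), smul_eq_mul]
          ring
  rw [hI, norm_mul, norm_neg, norm_inv]
  have hn2π : ‖(2 * Real.pi * Complex.I : ℂ)‖ = 2 * Real.pi := by simp [Real.pi_pos.le]
  rw [hn2π]
  calc (2 * Real.pi)⁻¹ * ‖∫ t, ((g' t : ℝ) : ℂ) * E t‖ ≤ (2 * Real.pi)⁻¹ * (K * (27 / 25 * N)) :=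
        mul_le_mul_of_nonneg_left hnorm (by positivity)
    _ = (27 / 25 / (2 * Real.pi)) * ((3 * M + 2) * Real.sqrt N / |B|) := by
        rw [hK, show (27 : ℝ) / 25 * N = 27 / 25 * (Real.sqrt N * Real.sqrt N) by rw [Real.mul_self_sqrt hN.le]]
        field_simp
    _ ≤ 1 * ((3 * M + 2) * Real.sqrt N / |B|) := by
        refine mul_le_mul_of_nonneg_right ?_ (by positivity)
        rw [div_le_one (by positivity)]
        linarith [Real.pi_gt_three]
    _ = _ := one_mul _

/-- For `m₁, m₂ ∼ N`: `|m₁ − m₂| ≤ 4√N |√m₁ − √m₂|` (as `√m₁ + √m₂ ≤ 2√(2N) ≤ 4√N`). [folklore] -/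
theorem abs_sub_le_sqrt_sub {N : ℝ} (hN : 0 ≤ N) {m₁ m₂ : ℕ} (h1 : m₁ ∈ dyadic N) (h2 : m₂ ∈ dyadic N) :
    |(m₁ : ℝ) - m₂| ≤ 4 * Real.sqrt N * |Real.sqrt m₁ - Real.sqrt m₂| := by
  have hm1 := ((mem_dyadic hN).1 h1).2
  have hm2 := ((mem_dyadic hN).1 h2).2
  have heq : (m₁ : ℝ) - m₂ = (Real.sqrt m₁ + Real.sqrt m₂) * (Real.sqrt m₁ - Real.sqrt m₂) := by
    rw [← sq_sub_sq, Real.sq_sqrt (Nat.cast_nonneg _), Real.sq_sqrt (Nat.cast_nonneg _)]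
  rw [heq, abs_mul, abs_of_nonneg (by positivity)]
  gcongr
  have h2N : Real.sqrt (2 * N) ≤ 2 * Real.sqrt N := by
    calc Real.sqrt (2 * N) ≤ Real.sqrt ((2 * Real.sqrt N) ^ 2) := Real.sqrt_le_sqrt (by nlinarith [Real.sq_sqrt hN])
      _ = 2 * Real.sqrt N := Real.sqrt_sq (by positivity)
  calc Real.sqrt m₁ + Real.sqrt m₂ ≤ Real.sqrt (2 * N) + Real.sqrt (2 * N) :=
        add_le_add (Real.sqrt_le_sqrt hm1) (Real.sqrt_le_sqrt hm2)
    _ ≤ 4 * Real.sqrt N := by linarith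

/-- **The off-diagonal zero frequency** ([DeshouillersIwaniec1982, p. 257: "`∫ f(ξ)dξ ≪ cN θ⁻¹|m₁ − m₂|⁻¹`
by partial integration"]): there is `C₁` with `‖𝓕f(0)‖ ≤ C₁ cN/(|θ||m₁ − m₂|)` for `κ = 0`,
`B = 2θ(√m₁ − √m₂)/c`, `m₁ ≠ m₂ ∼ N`, `θ ≠ 0`. [cite: DeshouillersIwaniec1982, §5.1 p. 257] -/
theorem norm_fourier_fFun_zero_offdiag : ∃ C₁ : ℝ, 0 ≤ C₁ ∧ ∀ (N θ : ℝ) (c m₁ m₂ : ℕ), 0 < N → θ ≠ 0 →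
    1 ≤ c → m₁ ∈ dyadic N → m₂ ∈ dyadic N → m₁ ≠ m₂ →
    ‖𝓕 (fFun N 0 (2 * θ * (Real.sqrt m₁ - Real.sqrt m₂) / c)) 0‖ ≤ C₁ * c * N / (|θ| * |(m₁ : ℝ) - m₂|) := by
  obtain ⟨C₀, hC0, hC⟩ := norm_fourier_fFun_zero_le_div
  refine ⟨2 * C₀, by positivity, fun N θ c m₁ m₂ hN hθ hc h1 h2 hne => ?_⟩
  have hc0 : (0 : ℝ) < c := by exact_mod_cast hc
  have hh : 0 < |(m₁ : ℝ) - m₂| := abs_pos.2 (sub_ne_zero.2 (by exact_mod_cast hne))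
  have hΔ := abs_sub_le_sqrt_sub hN.le h1 h2
  have hΔ0 : 0 < |Real.sqrt m₁ - Real.sqrt m₂| := by
    by_contra h0
    push Not at h0
    have : |(m₁ : ℝ) - m₂| ≤ 0 :=
      hΔ.trans (mul_nonpos_of_nonneg_of_nonpos (by positivity) h0)
    linarith
  have hBabs : |2 * θ * (Real.sqrt m₁ - Real.sqrt m₂) / c| = 2 * |θ| * |Real.sqrt m₁ - Real.sqrt m₂| / c := by
    rw [abs_div, abs_mul, abs_mul, abs_two, abs_of_pos hc0]
  have hB0 : 0 < |2 * θ * (Real.sqrt m₁ - Real.sqrt m₂) / c| := by rw [hBabs]; positivity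
  refine (hC N _ hN (abs_pos.1 hB0)).trans ?_
  rw [div_le_div_iff₀ hB0 (by positivity), hBabs,
    show 2 * C₀ * c * N * (2 * |θ| * |Real.sqrt m₁ - Real.sqrt m₂| / c) =
      C₀ * |θ| * N * (4 * |Real.sqrt m₁ - Real.sqrt m₂|) by field_simp; ring]
  calc C₀ * Real.sqrt N * (|θ| * |(m₁ : ℝ) - m₂|)
      ≤ C₀ * Real.sqrt N * (|θ| * (4 * Real.sqrt N * |Real.sqrt m₁ - Real.sqrt m₂|)) := by gcongr
    _ = C₀ * |θ| * (Real.sqrt N * Real.sqrt N) * (4 * |Real.sqrt m₁ - Real.sqrt m₂|) := by ring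
    _ = _ := by rw [Real.mul_self_sqrt hN.le]


/-! ### Cauchy–Schwarz, the smooth majorant and the opening of the Kloosterman sums -/

/-- The twisted linear forms `V(n) = ∑_{m ∼ N} b_m S(m, n; c) e(2θ√(mn)/c)`. [folklore] -/
def Vsum (θ : ℝ) (c : ℕ) (N : ℝ) (b : ℕ → ℂ) (n : ℕ) : ℂ :=
  ∑ m ∈ dyadic N, b m * kloo m n c * e (2 * θ * Real.sqrt ((m : ℝ) * n) / c)

/-- `B(θ, c, N) = ∑_n b̄_n V(n)`. [folklore] -/
theorem quadB_eq_sum_Vsum (θ : ℝ) (c : ℕ) (N : ℝ) (b : ℕ → ℂ) :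
    quadB θ c N b = ∑ n ∈ dyadic N, conj (b n) * Vsum θ c N b n := by
  unfold quadB Vsum
  rw [Finset.sum_comm]
  refine Finset.sum_congr rfl fun n _ => ?_
  rw [Finset.mul_sum]
  refine Finset.sum_congr rfl fun m _ => ?_
  ring

/-- **Cauchy–Schwarz in `n`** ([DeshouillersIwaniec1982, p. 256]): `‖B‖² ≤ ‖b‖² ∑_{n ∼ N} ‖V(n)‖²`.
[cite: DeshouillersIwaniec1982, §5.1 p. 256] -/
theorem norm_quadB_sq_le (θ : ℝ) (c : ℕ) (N : ℝ) (b : ℕ → ℂ) :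
    ‖quadB θ c N b‖ ^ 2 ≤ l2 N b * ∑ n ∈ dyadic N, ‖Vsum θ c N b n‖ ^ 2 := by
  rw [quadB_eq_sum_Vsum]
  have h1 : ‖∑ n ∈ dyadic N, conj (b n) * Vsum θ c N b n‖ ≤ ∑ n ∈ dyadic N, ‖b n‖ * ‖Vsum θ c N b n‖ := by
    refine (norm_sum_le _ _).trans (le_of_eq (Finset.sum_congr rfl fun n _ => ?_))
    rw [norm_mul, Complex.norm_conj]
  calc ‖∑ n ∈ dyadic N, conj (b n) * Vsum θ c N b n‖ ^ 2
      ≤ (∑ n ∈ dyadic N, ‖b n‖ * ‖Vsum θ c N b n‖) ^ 2 := pow_le_pow_left₀ (norm_nonneg _) h1 2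
    _ ≤ (∑ n ∈ dyadic N, ‖b n‖ ^ 2) * ∑ n ∈ dyadic N, ‖Vsum θ c N b n‖ ^ 2 := sum_mul_sq_le_sq_mul_sq _ _ _
    _ = _ := by rw [l2]

/-- `η₀(n/N) = 1` for `n ∼ N`. [folklore] -/
theorem eta0_scaled_eq_one {N : ℝ} (hN : 0 < N) {n : ℕ} (hn : n ∈ dyadic N) : (eta0 : ℝ → ℝ) (N⁻¹ * n) = 1 := by
  apply eta0.one_of_mem_closedBall
  obtain ⟨h1, h2⟩ := (mem_dyadic hN.le).1 hn
  rw [Metric.mem_closedBall, Real.dist_eq, show (eta0).rIn = 13 / 25 from rfl, inv_mul_eq_div, abs_le]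
  constructor
  · have : 1 < (n : ℝ) / N := (one_lt_div hN).2 h1
    linarith
  · have : (n : ℝ) / N ≤ 2 := (div_le_iff₀ hN).2 (by linarith)
    linarith

/-- **Smooth majorant** ([DeshouillersIwaniec1982, p. 256]): `∑_{n ∼ N} ‖V(n)‖² ≤ ∑_{n ≤ L} η₀(n/N)‖V(n)‖²`
for `L ≥ 2N`. [cite: DeshouillersIwaniec1982, §5.1 p. 256] -/
theorem sum_normSq_Vsum_le {N : ℝ} (hN : 0 < N) (θ : ℝ) (c : ℕ) (b : ℕ → ℂ) {L : ℕ} (hL : 2 * N ≤ L) :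
    ∑ n ∈ dyadic N, ‖Vsum θ c N b n‖ ^ 2 ≤
      ∑ n ∈ Finset.range (L + 1), (eta0 : ℝ → ℝ) (N⁻¹ * n) * ‖Vsum θ c N b n‖ ^ 2 := by
  have hsub : dyadic N ⊆ Finset.range (L + 1) := by
    intro n hn
    have h := ((mem_dyadic hN.le).1 hn).2
    rw [Finset.mem_range, Nat.lt_add_one_iff]
    exact_mod_cast h.trans hL
  calc ∑ n ∈ dyadic N, ‖Vsum θ c N b n‖ ^ 2
      = ∑ n ∈ dyadic N, (eta0 : ℝ → ℝ) (N⁻¹ * n) * ‖Vsum θ c N b n‖ ^ 2 :=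
        Finset.sum_congr rfl fun n hn => by rw [eta0_scaled_eq_one hN hn, one_mul]
    _ ≤ _ := Finset.sum_le_sum_of_subset_of_nonneg hsub fun n _ _ => mul_nonneg eta0.nonneg (sq_nonneg _)

/-- `(∑_m b_m ∑_d P_{m,d}) · conj(∑_m b_m ∑_d P_{m,d}) = ∑_{m₁,m₂} b_{m₁} b̄_{m₂} ∑_{d₁,d₂} P_{m₁d₁} P̄_{m₂d₂}`.
[folklore] -/
theorem sum_mul_conj_sum_expand {ι κ : Type*} (s : Finset ι) (t : Finset κ) (b : ι → ℂ) (P : ι → κ → ℂ) :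
    (∑ m₁ ∈ s, b m₁ * ∑ d₁ ∈ t, P m₁ d₁) * conj (∑ m₂ ∈ s, b m₂ * ∑ d₂ ∈ t, P m₂ d₂) =
      ∑ m₁ ∈ s, ∑ m₂ ∈ s, b m₁ * conj (b m₂) * ∑ d₁ ∈ t, ∑ d₂ ∈ t, P m₁ d₁ * conj (P m₂ d₂) := by
  rw [map_sum, Finset.sum_mul_sum]
  refine Finset.sum_congr rfl fun m₁ _ => Finset.sum_congr rfl fun m₂ _ => ?_
  rw [map_mul, map_sum]
  calc b m₁ * (∑ d₁ ∈ t, P m₁ d₁) * (conj (b m₂) * ∑ d₂ ∈ t, conj (P m₂ d₂))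
      = b m₁ * conj (b m₂) * ((∑ d₁ ∈ t, P m₁ d₁) * ∑ d₂ ∈ t, conj (P m₂ d₂)) := by ring
    _ = _ := by rw [Finset.sum_mul_sum]

/-- The summand identity behind the expansion:
`η₀(n/N) · e(n d̄₁/c) e(2θ√(m₁n)/c) · conj(e(n d̄₂/c) e(2θ√(m₂n)/c)) = f(n)` with `κ = (d̄₁ − d̄₂)/c`,
`B = 2θ(√m₁ − √m₂)/c`. [folklore] -/
theorem eta0_mul_eq_fFun {N : ℝ} (hN : 0 < N) (θ : ℝ) (c : ℕ) (m₁ m₂ d₁ d₂ n : ℕ) :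
    (((eta0 : ℝ → ℝ) (N⁻¹ * n) : ℝ) : ℂ) *
      ((e ((n : ℝ) * ((inv c d₁ : ℝ) / c)) * e (2 * θ * Real.sqrt ((m₁ : ℝ) * n) / c)) *
        conj (e ((n : ℝ) * ((inv c d₂ : ℝ) / c)) * e (2 * θ * Real.sqrt ((m₂ : ℝ) * n) / c))) =
      fFun N ((((inv c d₁ : ℤ) - (inv c d₂ : ℤ) : ℤ) : ℝ) / c) (2 * θ * (Real.sqrt m₁ - Real.sqrt m₂) / c) n := by
  rw [fFun_eq hN, map_mul, conj_e, conj_e, ← e_add, ← e_add, ← e_add, e_eq_exp]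
  congr 1
  congr 1
  rw [Real.sqrt_mul (Nat.cast_nonneg _), Real.sqrt_mul (Nat.cast_nonneg _)]
  push_cast
  ring

/-- **Opening the Kloosterman sums** ([DeshouillersIwaniec1982, p. 256, last display]):
`∑_n η₀(n/N)‖V(n)‖² = ∑_{m₁,m₂} b_{m₁} b̄_{m₂} ∑*_{d₁,d₂} e((m₁d₁ − m₂d₂)/c) ∑_n f(n)` with
`f(n) = η₀(n/N) e(n(d̄₁ − d̄₂)/c + 2θ(√m₁ − √m₂)√n/c)`. [cite: DeshouillersIwaniec1982, §5.1 p. 256] -/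
theorem sum_eta0_normSq_Vsum_eq {N : ℝ} (hN : 0 < N) (θ : ℝ) {c : ℕ} (hc : 0 < c) (b : ℕ → ℂ) (L : ℕ) :
    (((∑ n ∈ Finset.range (L + 1), (eta0 : ℝ → ℝ) (N⁻¹ * n) * ‖Vsum θ c N b n‖ ^ 2 : ℝ)) : ℂ) =
      ∑ m₁ ∈ dyadic N, ∑ m₂ ∈ dyadic N, b m₁ * conj (b m₂) *
        ∑ d₁ ∈ units c, ∑ d₂ ∈ units c, e ((m₁ : ℝ) * ((d₁ : ℝ) / c)) * conj (e ((m₂ : ℝ) * ((d₂ : ℝ) / c))) *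
          ∑ n ∈ Finset.range (L + 1),
            fFun N ((((inv c d₁ : ℤ) - (inv c d₂ : ℤ) : ℤ) : ℝ) / c) (2 * θ * (Real.sqrt m₁ - Real.sqrt m₂) / c) n := by
  -- pointwise in `n`
  have hpt : ∀ n : ℕ, ((((eta0 : ℝ → ℝ) (N⁻¹ * n) * ‖Vsum θ c N b n‖ ^ 2 : ℝ)) : ℂ) =
      ∑ m₁ ∈ dyadic N, ∑ m₂ ∈ dyadic N, b m₁ * conj (b m₂) *
        ∑ d₁ ∈ units c, ∑ d₂ ∈ units c, e ((m₁ : ℝ) * ((d₁ : ℝ) / c)) * conj (e ((m₂ : ℝ) * ((d₂ : ℝ) / c))) *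
          fFun N ((((inv c d₁ : ℤ) - (inv c d₂ : ℤ) : ℤ) : ℝ) / c) (2 * θ * (Real.sqrt m₁ - Real.sqrt m₂) / c) n := by
    intro n
    have hV : Vsum θ c N b n = ∑ m ∈ dyadic N, b m * ∑ d ∈ units c,
        e ((m : ℝ) * ((d : ℝ) / c)) * (e ((n : ℝ) * ((inv c d : ℝ) / c)) * e (2 * θ * Real.sqrt ((m : ℝ) * n) / c)) := by
      unfold Vsum
      refine Finset.sum_congr rfl fun m _ => ?_
      rw [kloo_eq_sum_units _ _ hc, mul_assoc, Finset.sum_mul]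
      push_cast
      refine congrArg _ (Finset.sum_congr rfl fun d _ => ?_)
      ring
    rw [Complex.ofReal_mul, ← Complex.normSq_eq_norm_sq, ← Complex.mul_conj, hV, sum_mul_conj_sum_expand,
      Finset.mul_sum]
    refine Finset.sum_congr rfl fun m₁ _ => ?_
    rw [Finset.mul_sum]
    refine Finset.sum_congr rfl fun m₂ _ => ?_
    rw [mul_left_comm, Finset.mul_sum]
    congr 1
    refine Finset.sum_congr rfl fun d₁ _ => ?_
    rw [Finset.mul_sum]
    refine Finset.sum_congr rfl fun d₂ _ => ?_
    rw [map_mul, ← eta0_mul_eq_fFun hN θ c m₁ m₂ d₁ d₂ n]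
    ring
  rw [Complex.ofReal_sum, Finset.sum_congr rfl fun n _ => hpt n, Finset.sum_comm]
  refine Finset.sum_congr rfl fun m₁ _ => ?_
  rw [Finset.sum_comm]
  refine Finset.sum_congr rfl fun m₂ _ => ?_
  rw [← Finset.mul_sum]
  congr 1
  rw [Finset.sum_comm]
  refine Finset.sum_congr rfl fun d₁ _ => ?_
  rw [Finset.sum_comm]
  refine Finset.sum_congr rfl fun d₂ _ => ?_
  rw [← Finset.mul_sum]

/-! ### The diagonal `d₁ = d₂`: Ramanujan sums -/

/-- `d ↦ d̄` is injective on the reduced residues. [folklore] -/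
theorem inv_injOn {c : ℕ} (hc : 0 < c) {d₁ d₂ : ℕ} (h1 : d₁ ∈ units c) (h2 : d₂ ∈ units c)
    (h : inv c d₁ = inv c d₂) : d₁ = d₂ := by
  haveI : NeZero c := ⟨hc.ne'⟩
  rw [units, Finset.mem_filter, Finset.mem_range] at h1 h2
  have h' : ((d₁ : ZMod c))⁻¹ = ((d₂ : ZMod c))⁻¹ := by
    have := congrArg (fun x : ℕ => (x : ZMod c)) h
    simpa [inv, ZMod.natCast_zmod_val] using this
  rw [inv_natCast_eq_unit h1.2, inv_natCast_eq_unit h2.2] at h'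
  have hu : (ZMod.unitOfCoprime d₁ h1.2)⁻¹ = (ZMod.unitOfCoprime d₂ h2.2)⁻¹ := Units.ext h'
  have hu' := congrArg (fun u : (ZMod c)ˣ => (u : ZMod c)) (inv_injective hu)
  simp only [ZMod.coe_unitOfCoprime] at hu'
  have := congrArg ZMod.val hu'
  rwa [ZMod.val_natCast, ZMod.val_natCast, Nat.mod_eq_of_lt h1.1, Nat.mod_eq_of_lt h2.1] at this

/-- `∑*_d e(m₁d/c) conj(e(m₂d/c)) = c_c(m₁ − m₂)` (the tree's `ramanujanSum`). [folklore] -/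
theorem sum_units_e_mul_conj_e (c m₁ m₂ : ℕ) :
    ∑ d ∈ units c, e ((m₁ : ℝ) * ((d : ℝ) / c)) * conj (e ((m₂ : ℝ) * ((d : ℝ) / c))) =
      ramanujanSum c ((m₁ : ℤ) - m₂) := by
  rw [ramanujanSum]
  refine Finset.sum_congr rfl fun d _ => ?_
  have : (m₁ : ℝ) * ((d : ℝ) / c) - m₂ * ((d : ℝ) / c) = (d : ℝ) * ((((m₁ : ℤ) - m₂ : ℤ)) : ℝ) / c := by
    push_cast; ring
  rw [← e_sub, this]

/-- **The diagonal terms**: summing `[d̄₁ = d̄₂] 𝓕f(0)` against `e(m₁d₁/c) conj e(m₂d₂/c)` gives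
`c_c(m₁ − m₂) · ∫ η₀(t/N) e(BΣ_N(t)) dt`. [cite: DeshouillersIwaniec1982, §5.1 p. 257] -/
theorem sum_units_ite_eq (N : ℝ) {c : ℕ} (hc : 0 < c) (m₁ m₂ : ℕ) (B : ℝ) :
    ∑ d₁ ∈ units c, ∑ d₂ ∈ units c, e ((m₁ : ℝ) * ((d₁ : ℝ) / c)) * conj (e ((m₂ : ℝ) * ((d₂ : ℝ) / c))) *
      (if ((inv c d₁ : ℤ) - (inv c d₂ : ℤ)) = 0 then
        𝓕 (fFun N ((((inv c d₁ : ℤ) - (inv c d₂ : ℤ) : ℤ) : ℝ) / c) B) 0 else 0) =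
      ramanujanSum c ((m₁ : ℤ) - m₂) * 𝓕 (fFun N 0 B) 0 := by
  rw [← sum_units_e_mul_conj_e, Finset.sum_mul]
  refine Finset.sum_congr rfl fun d₁ hd₁ => ?_
  rw [Finset.sum_eq_single_of_mem d₁ hd₁]
  · rw [if_pos (sub_self _), sub_self, Int.cast_zero, zero_div]
  · intro d₂ hd₂ hne
    rw [if_neg, mul_zero]
    intro h
    have h' : inv c d₁ = inv c d₂ := by exact_mod_cast sub_eq_zero.1 h
    exact hne (inv_injOn hc hd₁ hd₂ h').symm

/-- **The inner sum over `d₁, d₂`** ([DeshouillersIwaniec1982, p. 257]): Poisson summation in `n`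
(`norm_sum_fFun_sub_le`) for each pair and the diagonal (`sum_units_ite_eq`) give
`‖∑*_{d₁,d₂} e((m₁d₁ − m₂d₂)/c) ∑_n f(n)‖ ≤ c² K₁ c^p N^{1−p} + |c_c(m₁ − m₂)| ‖𝓕f₀(0)‖`.
[cite: DeshouillersIwaniec1982, §5.1 p. 257] -/
theorem norm_inner_le {p : ℕ} (hp : 2 ≤ p) :
    ∃ K₁ : ℝ, 0 ≤ K₁ ∧ ∀ (N θ : ℝ) (c m₁ m₂ L : ℕ), 0 < N → 1 ≤ c → |θ| ≤ 2 →
      m₁ ∈ dyadic N → m₂ ∈ dyadic N → 51 / 25 * N ≤ L →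
      ‖∑ d₁ ∈ units c, ∑ d₂ ∈ units c, e ((m₁ : ℝ) * ((d₁ : ℝ) / c)) * conj (e ((m₂ : ℝ) * ((d₂ : ℝ) / c))) *
          ∑ n ∈ Finset.range (L + 1),
            fFun N ((((inv c d₁ : ℤ) - (inv c d₂ : ℤ) : ℤ) : ℝ) / c) (2 * θ * (Real.sqrt m₁ - Real.sqrt m₂) / c) n‖ ≤
        (c : ℝ) ^ 2 * (K₁ * (c : ℝ) ^ p * N ^ (1 - (p : ℝ))) +
          ‖ramanujanSum c ((m₁ : ℤ) - m₂)‖ * ‖𝓕 (fFun N 0 (2 * θ * (Real.sqrt m₁ - Real.sqrt m₂) / c)) 0‖ := by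
  obtain ⟨K₁, hK0, hK⟩ := norm_sum_fFun_sub_le hp
  refine ⟨K₁, hK0, fun N θ c m₁ m₂ L hN hc hθ h1 h2 hL => ?_⟩
  have hc0 : 0 < c := hc
  set B : ℝ := 2 * θ * (Real.sqrt m₁ - Real.sqrt m₂) / c with hB
  set E : ℕ → ℕ → ℂ := fun d₁ d₂ => e ((m₁ : ℝ) * ((d₁ : ℝ) / c)) * conj (e ((m₂ : ℝ) * ((d₂ : ℝ) / c))) with hE
  set a : ℕ → ℕ → ℤ := fun d₁ d₂ => (inv c d₁ : ℤ) - (inv c d₂ : ℤ) with ha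
  set S : ℕ → ℕ → ℂ := fun d₁ d₂ => ∑ n ∈ Finset.range (L + 1), fFun N (((a d₁ d₂ : ℤ) : ℝ) / c) B n with hS
  set T : ℕ → ℕ → ℂ := fun d₁ d₂ => if a d₁ d₂ = 0 then 𝓕 (fFun N (((a d₁ d₂ : ℤ) : ℝ) / c) B) 0 else 0 with hT
  have hnE : ∀ d₁ d₂, ‖E d₁ d₂‖ = 1 := fun d₁ d₂ => by
    simp only [hE, norm_mul, norm_e, Complex.norm_conj, mul_one]
  have hsplit : ∑ d₁ ∈ units c, ∑ d₂ ∈ units c, E d₁ d₂ * S d₁ d₂ =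
      (∑ d₁ ∈ units c, ∑ d₂ ∈ units c, E d₁ d₂ * (S d₁ d₂ - T d₁ d₂)) +
        ramanujanSum c ((m₁ : ℤ) - m₂) * 𝓕 (fFun N 0 B) 0 := by
    rw [← sum_units_ite_eq N hc0 m₁ m₂ B, ← Finset.sum_add_distrib]
    refine Finset.sum_congr rfl fun d₁ _ => ?_
    rw [← Finset.sum_add_distrib]
    refine Finset.sum_congr rfl fun d₂ _ => ?_
    simp only [hE, hT, ha, hS]
    ring
  have ha_lt : ∀ d₁ d₂, |a d₁ d₂| < c := by
    intro d₁ d₂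
    haveI : NeZero c := ⟨hc0.ne'⟩
    have e1 : inv c d₁ < c := ZMod.val_lt _
    have e2 : inv c d₂ < c := ZMod.val_lt _
    simp only [ha]
    rw [abs_lt]
    constructor <;> omega
  have hcard : ((units c).card : ℝ) ≤ c := by
    have : (units c).card ≤ (Finset.range c).card := Finset.card_le_card (Finset.filter_subset _ _)
    rw [Finset.card_range] at this
    exact_mod_cast this
  have hterm : ∀ d₁ ∈ units c, ∀ d₂ ∈ units c, ‖E d₁ d₂ * (S d₁ d₂ - T d₁ d₂)‖ ≤ K₁ * (c : ℝ) ^ p * N ^ (1 - (p : ℝ)) := by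
    intro d₁ _ d₂ _
    rw [norm_mul, hnE, one_mul]
    exact hK N θ c m₁ m₂ (a d₁ d₂) L hN hc hθ h1 h2 (ha_lt d₁ d₂) hL
  have hmain : ‖∑ d₁ ∈ units c, ∑ d₂ ∈ units c, E d₁ d₂ * S d₁ d₂‖ ≤
      (c : ℝ) ^ 2 * (K₁ * (c : ℝ) ^ p * N ^ (1 - (p : ℝ))) + ‖ramanujanSum c ((m₁ : ℤ) - m₂)‖ * ‖𝓕 (fFun N 0 B) 0‖ := by
    rw [hsplit]
    calc ‖(∑ d₁ ∈ units c, ∑ d₂ ∈ units c, E d₁ d₂ * (S d₁ d₂ - T d₁ d₂)) +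
          ramanujanSum c ((m₁ : ℤ) - m₂) * 𝓕 (fFun N 0 B) 0‖
        ≤ ∑ d₁ ∈ units c, ∑ d₂ ∈ units c, ‖E d₁ d₂ * (S d₁ d₂ - T d₁ d₂)‖ +
          ‖ramanujanSum c ((m₁ : ℤ) - m₂)‖ * ‖𝓕 (fFun N 0 B) 0‖ := by
          refine (norm_add_le _ _).trans (add_le_add ((norm_sum_le _ _).trans
            (Finset.sum_le_sum fun d₁ _ => norm_sum_le _ _)) (norm_mul_le _ _))
      _ ≤ ∑ d₁ ∈ units c, ∑ d₂ ∈ units c, K₁ * (c : ℝ) ^ p * N ^ (1 - (p : ℝ)) +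
          ‖ramanujanSum c ((m₁ : ℤ) - m₂)‖ * ‖𝓕 (fFun N 0 B) 0‖ := by
          gcongr with d₁ hd₁ d₂ hd₂
          exact hterm d₁ hd₁ d₂ hd₂
      _ = (units c).card * ((units c).card * (K₁ * (c : ℝ) ^ p * N ^ (1 - (p : ℝ)))) +
          ‖ramanujanSum c ((m₁ : ℤ) - m₂)‖ * ‖𝓕 (fFun N 0 B) 0‖ := by
          rw [Finset.sum_const, Finset.sum_const, nsmul_eq_mul, nsmul_eq_mul]
      _ ≤ c * (c * (K₁ * (c : ℝ) ^ p * N ^ (1 - (p : ℝ)))) +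
          ‖ramanujanSum c ((m₁ : ℤ) - m₂)‖ * ‖𝓕 (fFun N 0 B) 0‖ := by
          have : 0 ≤ K₁ * (c : ℝ) ^ p * N ^ (1 - (p : ℝ)) := by positivity
          gcongr
      _ = _ := by ring
  exact hmain

/-! ### The arithmetic sums `∑ (h, c)/h` -/

/-- `∑_{h=1}^{K} (h, c)/h ≤ τ(c)(1 + log K)` ([DeshouillersIwaniec1982, p. 257: the factor `τ(c) log 2N`]).
[folklore] -/
theorem sum_gcd_div_le {c : ℕ} (hc : 0 < c) (K : ℕ) :
    ∑ h ∈ Finset.Icc 1 K, ((Nat.gcd h c : ℕ) : ℝ) / h ≤ (c.divisors.card : ℝ) * (1 + Real.log K) := by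
  rcases Nat.eq_zero_or_pos K with rfl | hK
  · rw [Finset.Icc_eq_empty (by omega), Finset.sum_empty]
    simp
  -- `(h, c)` is one of the divisors `d | c` with `d | h`
  have hpt : ∀ h ∈ Finset.Icc 1 K, ((Nat.gcd h c : ℕ) : ℝ) / h ≤
      ∑ d ∈ c.divisors, if d ∣ h then (d : ℝ) / h else 0 := by
    intro h _
    have hmem : Nat.gcd h c ∈ c.divisors := Nat.mem_divisors.2 ⟨Nat.gcd_dvd_right _ _, hc.ne'⟩
    rw [← Finset.add_sum_erase _ _ hmem, if_pos (Nat.gcd_dvd_left _ _)]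
    refine le_add_of_nonneg_right (Finset.sum_nonneg fun d _ => ?_)
    split_ifs <;> positivity
  refine (Finset.sum_le_sum hpt).trans ?_
  rw [Finset.sum_comm]
  -- each divisor contributes at most a harmonic sum
  have hharm : ∀ d ∈ c.divisors, ∑ h ∈ Finset.Icc 1 K, (if d ∣ h then (d : ℝ) / h else 0) ≤ 1 + Real.log K := by
    intro d hd
    have hd0 : 0 < d := Nat.pos_of_mem_divisors hd
    rw [← Finset.sum_filter]
    have hinj : Set.InjOn (fun h => h / d) ((Finset.Icc 1 K).filter (fun h => d ∣ h) : Set ℕ) := by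
      intro x hx y hy hxy
      simp only [Finset.coe_filter, Set.mem_setOf_eq] at hx hy
      have ex := Nat.div_mul_cancel hx.2
      have ey := Nat.div_mul_cancel hy.2
      have hxy' : x / d = y / d := hxy
      rw [← ex, ← ey, hxy']
    calc ∑ h ∈ (Finset.Icc 1 K).filter (fun h => d ∣ h), (d : ℝ) / h
        = ∑ h ∈ (Finset.Icc 1 K).filter (fun h => d ∣ h), (((h / d : ℕ)) : ℝ)⁻¹ := by
          refine Finset.sum_congr rfl fun h hh => ?_
          rw [Finset.mem_filter, Finset.mem_Icc] at hh
          obtain ⟨⟨hh1, _⟩, ⟨k, rfl⟩⟩ := hh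
          have hk0 : 0 < k := Nat.pos_of_ne_zero (by rintro rfl; simp at hh1)
          rw [Nat.mul_div_cancel_left k hd0]
          have hkR : (0 : ℝ) < k := by exact_mod_cast hk0
          have hdR : (0 : ℝ) < d := by exact_mod_cast hd0
          push_cast
          field_simp
      _ = ∑ k ∈ ((Finset.Icc 1 K).filter (fun h => d ∣ h)).image (fun h => h / d), (k : ℝ)⁻¹ :=
          (Finset.sum_image (f := fun k : ℕ => (k : ℝ)⁻¹) hinj).symm
      _ ≤ ∑ k ∈ Finset.Icc 1 K, (k : ℝ)⁻¹ := by
          refine Finset.sum_le_sum_of_subset_of_nonneg ?_ fun k _ _ => by positivity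
          intro k hk
          rw [Finset.mem_image] at hk
          obtain ⟨h, hh, rfl⟩ := hk
          rw [Finset.mem_filter, Finset.mem_Icc] at hh
          obtain ⟨⟨hh1, hh2⟩, ⟨j, rfl⟩⟩ := hh
          rw [Finset.mem_Icc, Nat.mul_div_cancel_left j hd0]
          constructor
          · exact Nat.pos_of_ne_zero (by rintro rfl; simp at hh1)
          · exact le_trans (Nat.le_mul_of_pos_left j hd0) hh2
      _ ≤ 1 + Real.log K := by
          have h := harmonic_le_one_add_log K
          rw [harmonic_eq_sum_Icc] at h
          push_cast at h
          exact h
  calc ∑ d ∈ c.divisors, ∑ h ∈ Finset.Icc 1 K, (if d ∣ h then (d : ℝ) / h else 0)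
      ≤ ∑ d ∈ c.divisors, (1 + Real.log K) := Finset.sum_le_sum hharm
    _ = _ := by rw [Finset.sum_const, nsmul_eq_mul]

/-- For `m ∼ N`: `∑_{m' ∼ N} (m − m', c)/|m − m'| ≤ 2 ∑_{h=1}^{⌊2N⌋} (h, c)/h` (the term `m' = m`
vanishes by the convention `x/0 = 0`). [folklore] -/
theorem sum_dyadic_gcd_div_le {N : ℝ} (hN : 0 ≤ N) (c : ℕ) {m : ℕ} (hm : m ∈ dyadic N) :
    ∑ m' ∈ dyadic N, ((Int.gcd ((m : ℤ) - m') c : ℕ) : ℝ) / |(m : ℝ) - m'| ≤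
      2 * ∑ h ∈ Finset.Icc 1 ⌊2 * N⌋₊, ((Nat.gcd h c : ℕ) : ℝ) / h := by
  set K := ⌊2 * N⌋₊ with hK
  set G : ℕ → ℝ := fun h => ((Nat.gcd h c : ℕ) : ℝ) / h with hG
  have hG0 : ∀ h, 0 ≤ G h := fun h => by positivity
  have hDK : ∀ x ∈ dyadic N, 1 ≤ x ∧ x ≤ K := fun x hx => by
    have h := (mem_dyadic hN).1 hx
    exact ⟨by exact_mod_cast (hN.trans_lt h.1 : (0 : ℝ) < x), Nat.le_floor h.2⟩
  have hsummand : ∀ m' : ℕ, ((Int.gcd ((m : ℤ) - m') c : ℕ) : ℝ) / |(m : ℝ) - m'| = G (((m : ℤ) - m').natAbs) := by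
    intro m'
    simp only [hG, Int.gcd_eq_natAbs_gcd_natAbs, Int.natAbs_natCast, Nat.cast_natAbs, Int.cast_abs, Int.cast_sub,
      Int.cast_natCast]
  rw [Finset.sum_congr rfl fun m' _ => hsummand m']
  have hle : ∀ m' ∈ dyadic N, G (((m : ℤ) - m').natAbs) ≤
      (if m' < m then G (m - m') else 0) + (if m < m' then G (m' - m) else 0) := by
    intro m' _
    rcases lt_trichotomy m' m with h | rfl | h
    · rw [if_pos h, if_neg (not_lt.2 h.le), add_zero]
      have : ((m : ℤ) - m').natAbs = m - m' := by omega
      rw [this]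
    · simp [hG]
    · rw [if_neg (not_lt.2 h.le), if_pos h, zero_add]
      have : ((m : ℤ) - m').natAbs = m' - m := by omega
      rw [this]
  refine (Finset.sum_le_sum hle).trans ?_
  rw [Finset.sum_add_distrib, two_mul]
  refine add_le_add ?_ ?_
  · rw [← Finset.sum_filter]
    have hinj : Set.InjOn (fun m' => m - m') ((dyadic N).filter (fun m' => m' < m) : Set ℕ) := by
      intro x hx y hy hxy
      simp only [Finset.coe_filter, Set.mem_setOf_eq] at hx hy
      have : m - x = m - y := hxy
      omega
    calc ∑ m' ∈ (dyadic N).filter (fun m' => m' < m), G (m - m')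
        = ∑ h ∈ ((dyadic N).filter (fun m' => m' < m)).image (fun m' => m - m'), G h :=
          (Finset.sum_image hinj).symm
      _ ≤ ∑ h ∈ Finset.Icc 1 K, G h := by
          refine Finset.sum_le_sum_of_subset_of_nonneg ?_ fun h _ _ => hG0 h
          intro h hh
          rw [Finset.mem_image] at hh
          obtain ⟨m', hm', rfl⟩ := hh
          rw [Finset.mem_filter] at hm'
          have e1 := hDK m hm
          have e2 := hDK m' hm'.1
          rw [Finset.mem_Icc]
          omega
  · rw [← Finset.sum_filter]
    have hinj : Set.InjOn (fun m' => m' - m) ((dyadic N).filter (fun m' => m < m') : Set ℕ) := by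
      intro x hx y hy hxy
      simp only [Finset.coe_filter, Set.mem_setOf_eq] at hx hy
      have : x - m = y - m := hxy
      omega
    calc ∑ m' ∈ (dyadic N).filter (fun m' => m < m'), G (m' - m)
        = ∑ h ∈ ((dyadic N).filter (fun m' => m < m')).image (fun m' => m' - m), G h :=
          (Finset.sum_image hinj).symm
      _ ≤ ∑ h ∈ Finset.Icc 1 K, G h := by
          refine Finset.sum_le_sum_of_subset_of_nonneg ?_ fun h _ _ => hG0 h
          intro h hh
          rw [Finset.mem_image] at hh
          obtain ⟨m', hm', rfl⟩ := hh
          rw [Finset.mem_filter] at hm'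
          have e1 := hDK m hm
          have e2 := hDK m' hm'.1
          rw [Finset.mem_Icc]
          omega


/-! ### Proposition 3, (1.27) -/

/-- `(∑_{m ∼ N} |b_m|)² ≤ #(m ∼ N) ‖b‖² ≤ 4N ‖b‖²` for `N ≥ 1/2` (Cauchy–Schwarz; the cardinality bound
is the tree's `BFI.card_dyadic_le_four_mul`, reproved inline to keep the imports light). [folklore] -/
theorem sum_norm_sq_le {N : ℝ} (hN : 1 / 2 ≤ N) (b : ℕ → ℂ) : (∑ m ∈ dyadic N, ‖b m‖) ^ 2 ≤ 4 * N * l2 N b := by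
  have hN0 : 0 ≤ N := by linarith
  have hcard : ((dyadic N).card : ℝ) ≤ 4 * N := by
    have hsub : dyadic N ⊆ Finset.Icc 1 ⌊2 * N⌋₊ := by
      intro m hm
      have h := (mem_dyadic hN0).1 hm
      rw [Finset.mem_Icc]
      refine ⟨?_, Nat.le_floor h.2⟩
      exact_mod_cast (hN0.trans_lt h.1 : (0 : ℝ) < m)
    calc ((dyadic N).card : ℝ) ≤ (Finset.Icc 1 ⌊2 * N⌋₊).card := by exact_mod_cast Finset.card_le_card hsub
      _ = ⌊2 * N⌋₊ := by simp [Nat.card_Icc]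
      _ ≤ 2 * N := Nat.floor_le (by linarith)
      _ ≤ 4 * N := by linarith
  have hCS := sum_mul_sq_le_sq_mul_sq (dyadic N) (fun m => ‖b m‖) (fun _ => (1 : ℝ))
  simp only [mul_one, one_pow, Finset.sum_const, nsmul_eq_mul] at hCS
  calc (∑ m ∈ dyadic N, ‖b m‖) ^ 2 ≤ (∑ m ∈ dyadic N, ‖b m‖ ^ 2) * (dyadic N).card := hCS
    _ ≤ (∑ m ∈ dyadic N, ‖b m‖ ^ 2) * (4 * N) :=
        mul_le_mul_of_nonneg_left hcard (Finset.sum_nonneg fun _ _ => sq_nonneg _)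
    _ = _ := by rw [l2]; ring

/-- **The bound for `W = ∑_n η₀(n/N)‖V(n)‖²`** ([DeshouillersIwaniec1982, p. 257, the three displays]):
for `p ≥ 2` there are `K₁, C₁ ≥ 0` with
`W ≤ ‖b‖² (4N·c²K₁c^pN^{1−p} + 1.08 cN + 2(∑_{h ≤ 2N}(h,c)/h) · C₁cN/|θ|)`
for `N ≥ 1`, `0 < |θ| ≤ 2`, `c ≥ 1`, `L ≥ 2.04N`: the error of Poisson summation, the diagonal
`m₁ = m₂` (`|c_c(0)| ≤ c`, `|∫f| ≤ 1.08N`) and the off-diagonal terms (`|c_c(h)| ≤ (h, c)`,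
`|∫f| ≤ C₁cN/(|θ||h|)`, `2|b₁b₂| ≤ |b₁|² + |b₂|²`). [cite: DeshouillersIwaniec1982, §5.1 p. 257] -/
theorem sum_eta0_normSq_Vsum_le {p : ℕ} (hp : 2 ≤ p) : ∃ K₁ C₁ : ℝ, 0 ≤ K₁ ∧ 0 ≤ C₁ ∧
    ∀ (N θ : ℝ) (c L : ℕ) (b : ℕ → ℂ), 1 ≤ N → 0 < |θ| → |θ| ≤ 2 → 1 ≤ c → 51 / 25 * N ≤ L →
      ∑ n ∈ Finset.range (L + 1), (eta0 : ℝ → ℝ) (N⁻¹ * n) * ‖Vsum θ c N b n‖ ^ 2 ≤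
        l2 N b * (4 * N * ((c : ℝ) ^ 2 * (K₁ * (c : ℝ) ^ p * N ^ (1 - (p : ℝ)))) + (c : ℝ) * (27 / 25 * N) +
          2 * (∑ h ∈ Finset.Icc 1 ⌊2 * N⌋₊, ((Nat.gcd h c : ℕ) : ℝ) / h) * (C₁ * c * N / |θ|)) := by
  obtain ⟨K₁, hK₁0, hK₁⟩ := norm_inner_le hp
  obtain ⟨C₁, hC₁0, hC₁⟩ := norm_fourier_fFun_zero_offdiag
  refine ⟨K₁, C₁, hK₁0, hC₁0, fun N θ c L b hN1 hθ0 hθ2 hc hL1 => ?_⟩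
  have hN : 0 < N := by linarith
  have hc0 : (0 : ℝ) < c := by exact_mod_cast hc
  have hcpos : 0 < c := hc
  have hl2 := l2_nonneg N b
  have hθne : θ ≠ 0 := abs_pos.1 hθ0
  set W : ℝ := ∑ n ∈ Finset.range (L + 1), (eta0 : ℝ → ℝ) (N⁻¹ * n) * ‖Vsum θ c N b n‖ ^ 2 with hW
  have hW0 : 0 ≤ W := Finset.sum_nonneg fun n _ => mul_nonneg eta0.nonneg (sq_nonneg _)
  set X₀ : ℝ := (c : ℝ) ^ 2 * (K₁ * (c : ℝ) ^ p * N ^ (1 - (p : ℝ))) with hX₀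
  set I : ℕ → ℕ → ℝ := fun m₁ m₂ => ‖𝓕 (fFun N 0 (2 * θ * (Real.sqrt m₁ - Real.sqrt m₂) / c)) 0‖ with hI
  set g : ℕ → ℕ → ℝ := fun m₁ m₂ => ((Int.gcd ((m₁ : ℤ) - m₂) c : ℕ) : ℝ) / |(m₁ : ℝ) - m₂| with hg
  set H : ℝ := ∑ h ∈ Finset.Icc 1 ⌊2 * N⌋₊, ((Nat.gcd h c : ℕ) : ℝ) / h with hH
  have hH0 : 0 ≤ H := Finset.sum_nonneg fun h _ => by positivity
  have hX₀0 : 0 ≤ X₀ := by positivity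
  -- the expansion, Poisson summation and the diagonal `d₁ = d₂`
  have hWle : W ≤ ∑ m₁ ∈ dyadic N, ∑ m₂ ∈ dyadic N, ‖b m₁‖ * ‖b m₂‖ *
      (X₀ + ‖ramanujanSum c ((m₁ : ℤ) - m₂)‖ * I m₁ m₂) := by
    have hWc : W = ‖((W : ℝ) : ℂ)‖ := by rw [Complex.norm_real, Real.norm_eq_abs, abs_of_nonneg hW0]
    rw [hWc, hW, sum_eta0_normSq_Vsum_eq hN θ hcpos b L]
    refine (norm_sum_le _ _).trans (Finset.sum_le_sum fun m₁ h1 => ?_)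
    refine (norm_sum_le _ _).trans (Finset.sum_le_sum fun m₂ h2 => ?_)
    rw [norm_mul, norm_mul, Complex.norm_conj]
    refine mul_le_mul_of_nonneg_left ?_ (by positivity)
    exact hK₁ N θ c m₁ m₂ L hN hc hθ2 h1 h2 hL1
  -- the Ramanujan part, pointwise
  have hRam : ∀ m₁ ∈ dyadic N, ∀ m₂ ∈ dyadic N,
      ‖b m₁‖ * ‖b m₂‖ * (‖ramanujanSum c ((m₁ : ℤ) - m₂)‖ * I m₁ m₂) ≤
        (if m₁ = m₂ then ‖b m₁‖ ^ 2 * ((c : ℝ) * (27 / 25 * N)) else 0) +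
          (‖b m₁‖ ^ 2 + ‖b m₂‖ ^ 2) / 2 * (C₁ * c * N / |θ|) * g m₁ m₂ := by
    intro m₁ h1 m₂ h2
    have hg0 : 0 ≤ g m₁ m₂ := by positivity
    by_cases heq : m₁ = m₂
    · subst heq
      rw [if_pos rfl]
      have hI' : I m₁ m₁ ≤ 27 / 25 * N := norm_fourier_fFun_zero_le hN _ _
      have hcc : ‖ramanujanSum c ((m₁ : ℤ) - m₁)‖ ≤ c := by
        refine (norm_ramanujanSum_le_totient _ _).trans ?_
        exact_mod_cast Nat.totient_le c
      calc ‖b m₁‖ * ‖b m₁‖ * (‖ramanujanSum c ((m₁ : ℤ) - m₁)‖ * I m₁ m₁)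
          ≤ ‖b m₁‖ * ‖b m₁‖ * ((c : ℝ) * (27 / 25 * N)) := by
            refine mul_le_mul_of_nonneg_left ?_ (by positivity)
            exact mul_le_mul hcc hI' (by positivity) (by positivity)
        _ = ‖b m₁‖ ^ 2 * ((c : ℝ) * (27 / 25 * N)) := by ring
        _ ≤ _ := le_add_of_nonneg_right (by positivity)
    · rw [if_neg heq, zero_add]
      have hI' : I m₁ m₂ ≤ C₁ * c * N / (|θ| * |(m₁ : ℝ) - m₂|) := hC₁ N θ c m₁ m₂ hN hθne hc h1 h2 heq
      have hcc : ‖ramanujanSum c ((m₁ : ℤ) - m₂)‖ ≤ ((Int.gcd ((m₁ : ℤ) - m₂) c : ℕ) : ℝ) :=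
        MatomakiMerikoski.norm_ramanujanSum_le_gcd _ _
      have hbb : ‖b m₁‖ * ‖b m₂‖ ≤ (‖b m₁‖ ^ 2 + ‖b m₂‖ ^ 2) / 2 := by
        nlinarith [sq_nonneg (‖b m₁‖ - ‖b m₂‖)]
      calc ‖b m₁‖ * ‖b m₂‖ * (‖ramanujanSum c ((m₁ : ℤ) - m₂)‖ * I m₁ m₂)
          ≤ (‖b m₁‖ ^ 2 + ‖b m₂‖ ^ 2) / 2 *
              ((((Int.gcd ((m₁ : ℤ) - m₂) c : ℕ) : ℝ)) * (C₁ * c * N / (|θ| * |(m₁ : ℝ) - m₂|))) :=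
            mul_le_mul hbb (mul_le_mul hcc hI' (by positivity) (by positivity)) (by positivity) (by positivity)
        _ = _ := by simp only [hg]; ring
  -- the arithmetic sums
  have hsumg₁ : ∀ m₁ ∈ dyadic N, ∑ m₂ ∈ dyadic N, g m₁ m₂ ≤ 2 * H := fun m₁ h1 =>
    sum_dyadic_gcd_div_le hN.le c h1
  have hsumg₂ : ∀ m₂ ∈ dyadic N, ∑ m₁ ∈ dyadic N, g m₁ m₂ ≤ 2 * H := by
    intro m₂ h2
    have hsymm : ∀ m₁, g m₁ m₂ = g m₂ m₁ := fun m₁ => by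
      simp only [hg]
      rw [abs_sub_comm, ← neg_sub ((m₂ : ℤ)) m₁, Int.neg_gcd]
    rw [Finset.sum_congr rfl fun m₁ _ => hsymm m₁]
    exact sum_dyadic_gcd_div_le hN.le c h2
  -- summation of the pointwise bounds
  refine hWle.trans ?_
  have hsplit : ∀ m₁ ∈ dyadic N, ∀ m₂ ∈ dyadic N,
      ‖b m₁‖ * ‖b m₂‖ * (X₀ + ‖ramanujanSum c ((m₁ : ℤ) - m₂)‖ * I m₁ m₂) ≤
        ‖b m₁‖ * ‖b m₂‖ * X₀ +
          ((if m₁ = m₂ then ‖b m₁‖ ^ 2 * ((c : ℝ) * (27 / 25 * N)) else 0) +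
            (‖b m₁‖ ^ 2 + ‖b m₂‖ ^ 2) / 2 * (C₁ * c * N / |θ|) * g m₁ m₂) := by
    intro m₁ h1 m₂ h2
    rw [mul_add]
    exact add_le_add le_rfl (hRam m₁ h1 m₂ h2)
  refine (Finset.sum_le_sum fun m₁ h1 => Finset.sum_le_sum fun m₂ h2 => hsplit m₁ h1 m₂ h2).trans ?_
  have hS1 : ∑ m₁ ∈ dyadic N, ∑ m₂ ∈ dyadic N, ‖b m₁‖ * ‖b m₂‖ * X₀ ≤ l2 N b * (4 * N * X₀) := by
    have heq : ∑ m₁ ∈ dyadic N, ∑ m₂ ∈ dyadic N, ‖b m₁‖ * ‖b m₂‖ * X₀ = (∑ m ∈ dyadic N, ‖b m‖) ^ 2 * X₀ := by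
      rw [sq, Finset.sum_mul_sum, Finset.sum_mul]
      refine Finset.sum_congr rfl fun m₁ _ => ?_
      rw [Finset.sum_mul]
    rw [heq]
    calc (∑ m ∈ dyadic N, ‖b m‖) ^ 2 * X₀ ≤ (4 * N * l2 N b) * X₀ :=
          mul_le_mul_of_nonneg_right (sum_norm_sq_le (by linarith) b) hX₀0
      _ = _ := by ring
  have hS2 : ∑ m₁ ∈ dyadic N, ∑ m₂ ∈ dyadic N,
      (if m₁ = m₂ then ‖b m₁‖ ^ 2 * ((c : ℝ) * (27 / 25 * N)) else 0) = l2 N b * ((c : ℝ) * (27 / 25 * N)) := by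
    rw [l2, Finset.sum_mul]
    refine Finset.sum_congr rfl fun m₁ h1 => ?_
    rw [Finset.sum_ite_eq, if_pos h1]
  have hS3 : ∑ m₁ ∈ dyadic N, ∑ m₂ ∈ dyadic N,
      (‖b m₁‖ ^ 2 + ‖b m₂‖ ^ 2) / 2 * (C₁ * c * N / |θ|) * g m₁ m₂ ≤ l2 N b * (2 * H * (C₁ * c * N / |θ|)) := by
    have hK0 : 0 ≤ C₁ * c * N / |θ| := by positivity
    have hrw : ∀ m₁ m₂, (‖b m₁‖ ^ 2 + ‖b m₂‖ ^ 2) / 2 * (C₁ * c * N / |θ|) * g m₁ m₂ =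
        (C₁ * c * N / |θ|) / 2 * (‖b m₁‖ ^ 2 * g m₁ m₂) + (C₁ * c * N / |θ|) / 2 * (‖b m₂‖ ^ 2 * g m₁ m₂) := by
      intro m₁ m₂; ring
    simp_rw [hrw, Finset.sum_add_distrib, ← Finset.mul_sum]
    rw [Finset.sum_comm (f := fun m₁ m₂ => ‖b m₂‖ ^ 2 * g m₁ m₂)]
    have hA : ∑ m₁ ∈ dyadic N, ‖b m₁‖ ^ 2 * ∑ m₂ ∈ dyadic N, g m₁ m₂ ≤ l2 N b * (2 * H) := by
      rw [l2, Finset.sum_mul]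
      exact Finset.sum_le_sum fun m₁ h1 => mul_le_mul_of_nonneg_left (hsumg₁ m₁ h1) (sq_nonneg _)
    have hB : ∑ m₂ ∈ dyadic N, ∑ m₁ ∈ dyadic N, ‖b m₂‖ ^ 2 * g m₁ m₂ ≤ l2 N b * (2 * H) := by
      rw [l2, Finset.sum_mul]
      refine Finset.sum_le_sum fun m₂ h2 => ?_
      rw [← Finset.mul_sum]
      exact mul_le_mul_of_nonneg_left (hsumg₂ m₂ h2) (sq_nonneg _)
    calc (C₁ * c * N / |θ|) / 2 * ∑ m₁ ∈ dyadic N, ‖b m₁‖ ^ 2 * ∑ m₂ ∈ dyadic N, g m₁ m₂ +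
          (C₁ * c * N / |θ|) / 2 * ∑ m₂ ∈ dyadic N, ∑ m₁ ∈ dyadic N, ‖b m₂‖ ^ 2 * g m₁ m₂
        ≤ (C₁ * c * N / |θ|) / 2 * (l2 N b * (2 * H)) + (C₁ * c * N / |θ|) / 2 * (l2 N b * (2 * H)) :=
          add_le_add (mul_le_mul_of_nonneg_left hA (by positivity)) (mul_le_mul_of_nonneg_left hB (by positivity))
      _ = _ := by ring
  have hdist : ∑ m₁ ∈ dyadic N, ∑ m₂ ∈ dyadic N, (‖b m₁‖ * ‖b m₂‖ * X₀ +
      ((if m₁ = m₂ then ‖b m₁‖ ^ 2 * ((c : ℝ) * (27 / 25 * N)) else 0) +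
        (‖b m₁‖ ^ 2 + ‖b m₂‖ ^ 2) / 2 * (C₁ * c * N / |θ|) * g m₁ m₂)) =
      (∑ m₁ ∈ dyadic N, ∑ m₂ ∈ dyadic N, ‖b m₁‖ * ‖b m₂‖ * X₀) +
      ((∑ m₁ ∈ dyadic N, ∑ m₂ ∈ dyadic N,
          (if m₁ = m₂ then ‖b m₁‖ ^ 2 * ((c : ℝ) * (27 / 25 * N)) else 0)) +
        ∑ m₁ ∈ dyadic N, ∑ m₂ ∈ dyadic N,
          (‖b m₁‖ ^ 2 + ‖b m₂‖ ^ 2) / 2 * (C₁ * c * N / |θ|) * g m₁ m₂) := by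
    simp only [Finset.sum_add_distrib]
  rw [hdist, hS2]
  calc _ ≤ l2 N b * (4 * N * X₀) + (l2 N b * ((c : ℝ) * (27 / 25 * N)) + l2 N b * (2 * H * (C₁ * c * N / |θ|))) :=
        add_le_add hS1 (add_le_add le_rfl hS3)
    _ = _ := by ring

/-- `∑_{h ≤ 2N} (h, c)/h ≤ C_τ (2 + 1/ε) N^{2ε}` for `1 ≤ c ≤ N` (`τ(c) ≤ C_τ c^ε`, `log ≤ N^ε/ε`).
[folklore] -/
theorem sum_gcd_div_le_rpow {ε : ℝ} (hε : 0 < ε) : ∃ Cτ : ℝ, 0 ≤ Cτ ∧ ∀ (N : ℝ) (c : ℕ), 1 ≤ N → 1 ≤ c →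
    (c : ℝ) ≤ N → ∑ h ∈ Finset.Icc 1 ⌊2 * N⌋₊, ((Nat.gcd h c : ℕ) : ℝ) / h ≤ Cτ * (2 + 1 / ε) * N ^ (2 * ε) := by
  obtain ⟨Cτ, hCτ1, hCτ⟩ := exists_card_divisors_le_mul_rpow hε
  have hCτ0 : 0 ≤ Cτ := by linarith
  refine ⟨Cτ, hCτ0, fun N c hN1 hc hcN => ?_⟩
  have hN : 0 < N := by linarith
  have hc0 : (0 : ℝ) < c := by exact_mod_cast hc
  have hcpos : 0 < c := hc
  have hfl : (1 : ℝ) ≤ (⌊2 * N⌋₊ : ℕ) := by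
    have : 1 ≤ ⌊2 * N⌋₊ := Nat.le_floor (by push_cast; linarith)
    exact Nat.one_le_cast.2 this
  have hτ : (c.divisors.card : ℝ) ≤ Cτ * N ^ ε := by
    refine (hCτ c hcpos.ne').trans ?_
    exact mul_le_mul_of_nonneg_left (Real.rpow_le_rpow hc0.le hcN hε.le) hCτ0
  have hK2 : (1 : ℝ) + Real.log (⌊2 * N⌋₊ : ℕ) ≤ 2 + N ^ ε / ε := by
    have hlog : Real.log (⌊2 * N⌋₊ : ℕ) ≤ Real.log (2 * N) :=
      Real.log_le_log (by linarith) (Nat.floor_le (by linarith))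
    have hlog2 : Real.log (2 * N) = Real.log 2 + Real.log N := Real.log_mul (by norm_num) hN.ne'
    have hl2' : Real.log 2 ≤ 1 := by
      have := Real.log_le_sub_one_of_pos (show (0 : ℝ) < 2 by norm_num); linarith
    have hlN : Real.log N ≤ N ^ ε / ε := Real.log_le_rpow_div hN.le hε
    linarith
  have hK20 : (0 : ℝ) ≤ 1 + Real.log (⌊2 * N⌋₊ : ℕ) := by
    have := Real.log_nonneg hfl; linarith
  have hNε1 : (1 : ℝ) ≤ N ^ ε := Real.one_le_rpow hN1 hε.le
  have hNε2 : N ^ ε * N ^ ε = N ^ (2 * ε) := by rw [← Real.rpow_add hN]; ring_nf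
  calc ∑ h ∈ Finset.Icc 1 ⌊2 * N⌋₊, ((Nat.gcd h c : ℕ) : ℝ) / h
      ≤ (c.divisors.card : ℝ) * (1 + Real.log (⌊2 * N⌋₊ : ℕ)) := sum_gcd_div_le hcpos _
    _ ≤ (Cτ * N ^ ε) * (2 + N ^ ε / ε) := mul_le_mul hτ hK2 hK20 (by positivity)
    _ ≤ (Cτ * N ^ ε) * ((2 + 1 / ε) * N ^ ε) := by
        refine mul_le_mul_of_nonneg_left ?_ (by positivity)
        rw [add_mul]
        exact add_le_add (by nlinarith) (le_of_eq (by ring))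
    _ = Cτ * (2 + 1 / ε) * (N ^ ε * N ^ ε) := by ring
    _ = _ := by rw [hNε2]

/-- For `c ≤ N^{1−ε}`, `N ≥ 1` and `ε(p + 1) ≥ 2`: `c^{p+1} N^{1−p} ≤ 1`. [folklore] -/
theorem pow_mul_rpow_le_one {ε N : ℝ} {c p : ℕ} (hN1 : 1 ≤ N) (hcase : (c : ℝ) ≤ N ^ (1 - ε))
    (hpε : 2 ≤ ε * ((p : ℝ) + 1)) : (c : ℝ) ^ (p + 1) * N ^ (1 - (p : ℝ)) ≤ 1 := by
  have hN : 0 < N := by linarith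
  have h1 : (c : ℝ) ^ (p + 1) ≤ (N ^ (1 - ε)) ^ (p + 1) := pow_le_pow_left₀ (Nat.cast_nonneg _) hcase _
  have h2 : (N ^ (1 - ε)) ^ (p + 1) * N ^ (1 - (p : ℝ)) = N ^ ((1 - ε) * ((p : ℝ) + 1) + (1 - p)) := by
    rw [← Real.rpow_natCast, ← Real.rpow_mul hN.le, ← Real.rpow_add hN]
    push_cast
    ring_nf
  have h3 : (1 - ε) * ((p : ℝ) + 1) + (1 - p) ≤ 0 := by
    have : (1 - ε) * ((p : ℝ) + 1) = (p + 1) - ε * (p + 1) := by ring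
    linarith
  calc (c : ℝ) ^ (p + 1) * N ^ (1 - (p : ℝ)) ≤ (N ^ (1 - ε)) ^ (p + 1) * N ^ (1 - (p : ℝ)) :=
        mul_le_mul_of_nonneg_right h1 (by positivity)
    _ = N ^ ((1 - ε) * ((p : ℝ) + 1) + (1 - p)) := h2
    _ ≤ N ^ (0 : ℝ) := Real.rpow_le_rpow_of_exponent_le hN1 h3
    _ = 1 := Real.rpow_zero _

/-- **Proposition 3, (1.27)** of [DeshouillersIwaniec1982] (the bound for short moduli): for every
`ε > 0` there is `A = A(ε)` such that for `0 < |θ| ≤ 2` and `1 ≤ c ≤ N`,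

  `‖B(θ, c, N)‖ ≤ A |θ|^{-1/2} c^{1/2} N^{1/2+ε} ‖b‖²`.

Proof as printed (§5.1 pp. 256–257): Cauchy–Schwarz and a smooth majorant in `n`, opening of the
Kloosterman sums, Poisson summation; the non-zero frequencies are negligible after `p ≍ 1/ε` partial
integrations when `c ≤ N^{1−ε}`, the zero frequency gives Ramanujan sums against
`∫ η₀(t/N)e(B√t)dt ≪ min(N, cN/(θ|m₁ − m₂|))`, and `∑ (h,c)/h ≪ τ(c) log 2N` (`sum_eta0_normSq_Vsum_le`);
for `N^{1−ε} < c ≤ N` the claim follows from (1.26) (`norm_quadB_le_largeSieve`).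
[cite: DeshouillersIwaniec1982, Proposition 3 (1.27)] -/
theorem norm_quadB_le_short {ε : ℝ} (hε : 0 < ε) :
    ∃ A : ℝ, 0 ≤ A ∧ ∀ (θ : ℝ) (c : ℕ) (N : ℝ) (b : ℕ → ℂ), 0 < |θ| → |θ| ≤ 2 → 1 ≤ c → (c : ℝ) ≤ N →
      ‖quadB θ c N b‖ ≤ A * |θ| ^ (-(1 / 2 : ℝ)) * Real.sqrt c * N ^ (1 / 2 + ε) * l2 N b := by
  -- the number of partial integrations
  obtain ⟨p, hp_def⟩ : ∃ p : ℕ, p = ⌈2 / ε⌉₊ + 1 := ⟨_, rfl⟩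
  have hp2 : 2 ≤ p := by
    have : 1 ≤ ⌈2 / ε⌉₊ := Nat.one_le_iff_ne_zero.2 (Nat.ceil_pos.2 (by positivity)).ne'
    omega
  have hpε : 2 ≤ ε * ((p : ℝ) + 1) := by
    have h1 : 2 / ε ≤ ⌈2 / ε⌉₊ := Nat.le_ceil _
    have h2 : ((p : ℝ) + 1) = ⌈2 / ε⌉₊ + 2 := by rw [hp_def]; push_cast; ring
    rw [h2]
    calc (2 : ℝ) = ε * (2 / ε) := by field_simp
      _ ≤ ε * (⌈2 / ε⌉₊ + 2) := by gcongr; linarith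
  obtain ⟨K₁, C₁, hK₁0, hC₁0, hW⟩ := sum_eta0_normSq_Vsum_le hp2
  obtain ⟨Cτ, hCτ0, hCτ⟩ := sum_gcd_div_le_rpow hε
  set A₁ : ℝ := 2 * (4 * K₁ + 27 / 25) + 2 * C₁ * Cτ * (2 + 1 / ε) with hA₁
  have hA₁0 : 0 ≤ A₁ := by positivity
  have hQ := quadBLSConst_pos
  refine ⟨Real.sqrt A₁ + 8 * quadBLSConst, by positivity, ?_⟩
  intro θ c N b hθ0 hθ2 hc hcN
  have hc0 : (0 : ℝ) < c := by exact_mod_cast hc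
  have hN1 : (1 : ℝ) ≤ N := le_trans (by exact_mod_cast hc) hcN
  have hN : 0 < N := by linarith
  have hl2 := l2_nonneg N b
  -- `|θ|^{-1/2} ≥ 1/2`
  have hθpow : (2 : ℝ)⁻¹ ≤ |θ| ^ (-(1 / 2 : ℝ)) := by
    have h1 : |θ| ^ (1 / 2 : ℝ) ≤ 2 := by
      calc |θ| ^ (1 / 2 : ℝ) ≤ 2 ^ (1 / 2 : ℝ) := Real.rpow_le_rpow (abs_nonneg _) hθ2 (by norm_num)
        _ ≤ 2 ^ (1 : ℝ) := Real.rpow_le_rpow_of_exponent_le one_le_two (by norm_num)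
        _ = 2 := Real.rpow_one 2
    have h2 : 0 < |θ| ^ (1 / 2 : ℝ) := Real.rpow_pos_of_pos hθ0 _
    rw [Real.rpow_neg (abs_nonneg θ), le_inv_comm₀ (by norm_num) h2, inv_inv]
    exact h1
  set R : ℝ := |θ| ^ (-(1 / 2 : ℝ)) * Real.sqrt c * N ^ (1 / 2 + ε) * l2 N b with hR
  have hR0 : 0 ≤ R := by positivity
  have hgoal : ∀ A' : ℝ, A' ≤ Real.sqrt A₁ + 8 * quadBLSConst → ‖quadB θ c N b‖ ≤ A' * R →
      ‖quadB θ c N b‖ ≤ (Real.sqrt A₁ + 8 * quadBLSConst) * |θ| ^ (-(1 / 2 : ℝ)) * Real.sqrt c *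
        N ^ (1 / 2 + ε) * l2 N b := by
    intro A' hA' h
    calc ‖quadB θ c N b‖ ≤ A' * R := h
      _ ≤ (Real.sqrt A₁ + 8 * quadBLSConst) * R := mul_le_mul_of_nonneg_right hA' hR0
      _ = _ := by rw [hR]; ring
  by_cases hcase : (c : ℝ) ≤ N ^ (1 - ε)
  · /- Case `c ≤ N^{1-ε}`: Poisson summation. -/
    refine hgoal (Real.sqrt A₁) (le_add_of_nonneg_right (by positivity)) ?_
    obtain ⟨L, hL⟩ : ∃ L : ℕ, L = ⌈51 / 25 * N⌉₊ := ⟨_, rfl⟩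
    have hL1 : 51 / 25 * N ≤ L := by rw [hL]; exact Nat.le_ceil _
    have hL2 : 2 * N ≤ L := le_trans (by linarith) hL1
    have hstep1 : ‖quadB θ c N b‖ ^ 2 ≤
        l2 N b * ∑ n ∈ Finset.range (L + 1), (eta0 : ℝ → ℝ) (N⁻¹ * n) * ‖Vsum θ c N b n‖ ^ 2 :=
      (norm_quadB_sq_le θ c N b).trans (mul_le_mul_of_nonneg_left (sum_normSq_Vsum_le hN θ c b hL2) hl2)
    have hstep2 := hW N θ c L b hN1 hθ0 hθ2 hc hL1
    set X₀ : ℝ := (c : ℝ) ^ 2 * (K₁ * (c : ℝ) ^ p * N ^ (1 - (p : ℝ))) with hX₀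
    set H : ℝ := ∑ h ∈ Finset.Icc 1 ⌊2 * N⌋₊, ((Nat.gcd h c : ℕ) : ℝ) / h with hH
    have hH0 : 0 ≤ H := Finset.sum_nonneg fun h _ => by positivity
    have hX₀le : 4 * N * X₀ ≤ 4 * K₁ * (c * N) := by
      have hcp := pow_mul_rpow_le_one (p := p) hN1 hcase hpε
      calc 4 * N * X₀ = 4 * K₁ * (c * N) * ((c : ℝ) ^ (p + 1) * N ^ (1 - (p : ℝ))) := by
            rw [hX₀]; ring
        _ ≤ 4 * K₁ * (c * N) * 1 := mul_le_mul_of_nonneg_left hcp (by positivity)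
        _ = _ := mul_one _
    have hHle : H ≤ Cτ * (2 + 1 / ε) * N ^ (2 * ε) := hCτ N c hN1 hc hcN
    have hbr : 4 * N * X₀ + (c : ℝ) * (27 / 25 * N) + 2 * H * (C₁ * c * N / |θ|) ≤
        A₁ * (|θ|⁻¹ * (c * (N * N ^ (2 * ε)))) := by
      have hθinv : (1 : ℝ) ≤ 2 * |θ|⁻¹ := by
        rw [← div_eq_mul_inv, le_div_iff₀ hθ0]; linarith
      have hN2ε : (1 : ℝ) ≤ N ^ (2 * ε) := Real.one_le_rpow hN1 (by positivity)
      have h12 : 4 * N * X₀ + (c : ℝ) * (27 / 25 * N) ≤ (4 * K₁ + 27 / 25) * (c * N) := by nlinarith [hX₀le]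
      have h12' : (4 * K₁ + 27 / 25) * ((c : ℝ) * N) ≤
          2 * (4 * K₁ + 27 / 25) * (|θ|⁻¹ * (c * (N * N ^ (2 * ε)))) := by
        have : (c : ℝ) * N ≤ (2 * |θ|⁻¹) * (c * N) * N ^ (2 * ε) := by
          calc (c : ℝ) * N = 1 * (c * N) * 1 := by ring
            _ ≤ (2 * |θ|⁻¹) * (c * N) * N ^ (2 * ε) := by gcongr
        calc (4 * K₁ + 27 / 25) * ((c : ℝ) * N) ≤ (4 * K₁ + 27 / 25) * ((2 * |θ|⁻¹) * (c * N) * N ^ (2 * ε)) :=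
              mul_le_mul_of_nonneg_left this (by positivity)
          _ = _ := by ring
      have h3 : 2 * H * (C₁ * c * N / |θ|) ≤ 2 * C₁ * Cτ * (2 + 1 / ε) * (|θ|⁻¹ * (c * (N * N ^ (2 * ε)))) := by
        calc 2 * H * (C₁ * c * N / |θ|) ≤ 2 * (Cτ * (2 + 1 / ε) * N ^ (2 * ε)) * (C₁ * c * N / |θ|) := by
              gcongr
          _ = _ := by rw [div_eq_mul_inv]; ring
      calc _ ≤ 2 * (4 * K₁ + 27 / 25) * (|θ|⁻¹ * (c * (N * N ^ (2 * ε)))) +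
            2 * C₁ * Cτ * (2 + 1 / ε) * (|θ|⁻¹ * (c * (N * N ^ (2 * ε)))) := add_le_add (h12.trans h12') h3
        _ = _ := by rw [hA₁]; ring
    have hR2 : R ^ 2 = |θ|⁻¹ * (c * (N * N ^ (2 * ε))) * l2 N b ^ 2 := by
      have e1 : (|θ| ^ (-(1 / 2 : ℝ))) ^ 2 = |θ|⁻¹ := by
        rw [← Real.rpow_natCast, ← Real.rpow_mul (abs_nonneg θ), ← Real.rpow_neg_one]
        norm_num
      have e2 : Real.sqrt (c : ℝ) ^ 2 = c := Real.sq_sqrt hc0.le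
      have e3 : (N ^ (1 / 2 + ε)) ^ 2 = N * N ^ (2 * ε) := by
        rw [← Real.rpow_natCast, ← Real.rpow_mul hN.le,
          show (1 / 2 + ε) * ((2 : ℕ) : ℝ) = 1 + 2 * ε by push_cast; ring, Real.rpow_add hN, Real.rpow_one]
      rw [hR]
      calc (|θ| ^ (-(1 / 2 : ℝ)) * Real.sqrt c * N ^ (1 / 2 + ε) * l2 N b) ^ 2
          = (|θ| ^ (-(1 / 2 : ℝ))) ^ 2 * Real.sqrt (c : ℝ) ^ 2 * (N ^ (1 / 2 + ε)) ^ 2 * l2 N b ^ 2 := by ring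
        _ = _ := by rw [e1, e2, e3]; ring
    have hsq : ‖quadB θ c N b‖ ^ 2 ≤ (Real.sqrt A₁ * R) ^ 2 := by
      rw [mul_pow, Real.sq_sqrt hA₁0, hR2]
      calc ‖quadB θ c N b‖ ^ 2
          ≤ l2 N b * (l2 N b * (4 * N * X₀ + (c : ℝ) * (27 / 25 * N) + 2 * H * (C₁ * c * N / |θ|))) :=
            hstep1.trans (mul_le_mul_of_nonneg_left hstep2 hl2)
        _ ≤ l2 N b * (l2 N b * (A₁ * (|θ|⁻¹ * (c * (N * N ^ (2 * ε)))))) := by gcongr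
        _ = _ := by ring
    exact (pow_le_pow_iff_left₀ (norm_nonneg _) (by positivity) two_ne_zero).1 hsq
  · /- Case `N^{1-ε} < c ≤ N`: the large sieve bound (1.26). -/
    push Not at hcase
    refine hgoal (8 * quadBLSConst) (le_add_of_nonneg_left (Real.sqrt_nonneg _)) ?_
    have hLS : ‖quadB θ c N b‖ ≤ quadBLSConst * (c + N + |θ| * N) * l2 N b :=
      norm_quadB_le_largeSieve θ hc (by linarith) b
    have h4 : (c : ℝ) + N + |θ| * N ≤ 4 * N := by nlinarith [mul_le_mul_of_nonneg_right hθ2 hN.le]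
    have hsc : N ^ ((1 - ε) / 2) ≤ Real.sqrt c := by
      rw [Real.sqrt_eq_rpow, show (1 - ε) / 2 = (1 - ε) * (1 / 2) by ring, Real.rpow_mul hN.le]
      exact Real.rpow_le_rpow (by positivity) hcase.le (by norm_num)
    have hNle : N ≤ Real.sqrt c * N ^ (1 / 2 + ε) := by
      calc N = N ^ (1 : ℝ) := (Real.rpow_one N).symm
        _ ≤ N ^ ((1 - ε) / 2 + (1 / 2 + ε)) := Real.rpow_le_rpow_of_exponent_le hN1 (by linarith)
        _ = N ^ ((1 - ε) / 2) * N ^ (1 / 2 + ε) := Real.rpow_add hN _ _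
        _ ≤ Real.sqrt c * N ^ (1 / 2 + ε) := mul_le_mul_of_nonneg_right hsc (by positivity)
    calc ‖quadB θ c N b‖ ≤ quadBLSConst * (c + N + |θ| * N) * l2 N b := hLS
      _ ≤ quadBLSConst * (4 * N) * l2 N b := by gcongr
      _ = 8 * quadBLSConst * (2⁻¹ * N * l2 N b) := by ring
      _ ≤ 8 * quadBLSConst * (|θ| ^ (-(1 / 2 : ℝ)) * (Real.sqrt c * N ^ (1 / 2 + ε)) * l2 N b) := by gcongr
      _ = 8 * quadBLSConst * R := by rw [hR]; ring

end DeshouillersIwaniec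

end Literature.NumberTheory.Sieve
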